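import Summits.RiemannHypothesis.RiemannHypothesis.Theses.SpectralTrace
import Summits.RiemannHypothesis.RiemannHypothesis.Theorems.SpectralTraceWindowCompactness
import Summits.RiemannHypothesis.RiemannHypothesis.Theorems.SpectralIsHpSpectrum.Negative.RefutationImpliesRH
import Summits.RiemannHypothesis.RiemannHypothesis.Theorems.WindowTraceArch.Negative.FiniteSpectrum
import Summits.RiemannHypothesis.RiemannHypothesis.Theorems.WindowTraceArch.Negative.WithoutIsWeilTest
import Summits.RiemannHypothesis.RiemannHypothesis.Theorems.WindowTraceArch.Negative.ComplexSpectrum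
import Summits.RiemannHypothesis.RiemannHypothesis.Theorems.WindowTraceArch.Negative.BoundedDensity
import Summits.RiemannHypothesis.RiemannHypothesis.Theorems.WindowTraceArch.Negative.UnitMass
import Summits.RiemannHypothesis.RiemannHypothesis.Theorems.WindowTraceArch.Negative.LocalWeyl
import Literature.NumberTheory.LFunctions.WeilWindowSimpleEven
import Literature.NumberTheory.LFunctions.WeilMellinBounds
import Literature.NumberTheory.LFunctions.WeilMellinInversion
import Literature.NumberTheory.LFunctions.WeilSmallSupportPositivity
import Literature.NumberTheory.LFunctions.WeilArchimedeanMoments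
import Literature.NumberTheory.LFunctions.WeilArchimedeanPositivityProofs
import Literature.NumberTheory.LFunctions.WeilGroundState
import Literature.NumberTheory.LFunctions.WeilGroundEnergyProofs
import Literature.NumberTheory.LFunctions.WeilCriterionProofs
import Literature.NumberTheory.LFunctions.ZetaRealAxis
import Literature.NumberTheory.LFunctions.GeneralizedRH
import Mathlib.Analysis.MellinTransform
import Mathlib.Analysis.SpecialFunctions.Integrals.Basic
import Mathlib.Analysis.Complex.LocallyUniformLimit
import Mathlib.Logic.Denumerable

/-!
# Disproof work file for the crux `SpectralThesis` (stmt-RiemannHypothesis-0187) — thesis `X` of route SpectralTrace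

Standing adversary file (refuter, cdisprove seat `refuter-cdisprove-stmt-RiemannHypothesis-0187-0`).
Prose lives only in docstrings. Everything below is kernel-checked; nothing is sorried.

The crux (route target, rank 0):
`SpectralThesis : Prop := ∃ (ι : Type) (γ : ι → ℝ), ∀ g, IsWeilTest g →
   HasSum (fun i => weilMellin g (1/2 + γ i * I)) (weilFunctional g)`
("the Weil distribution is the Fourier–Stieltjes transform of a positive integer-atomic measure
`Σ_i δ_{γ_i}` on the REAL line").

## Findings (indexed; details in the docstrings)

* §1 WHY NO UNCONDITIONAL KILL EXISTS — `spectralThesis_iff_riemannHypothesis : X ↔ RH`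
  (kernel-checked from landed modules: `riemannHypothesis_of_trace` = Bochner form + Weil's
  criterion `weil_criterion_holds`; `spectralThesis_of_riemannHypothesis` = explicit formula with
  absolute convergence read on the critical line). Hence `¬ X ↔ ¬ RH`: a disproof of the crux is a
  disproof of the Riemann hypothesis; no finite computation, small model or degenerate instance can
  refute it (RH is verified far beyond any range a cheap search reaches). `spectralThesis_iff_ladder`:
  `X ↔ ∀ A > 0, Trace(A)` (the window ladder, landed `windowCompactness_proof`).
* §2 LOAD-BEARING HYPOTHESES.
  - `spectralThesis_false_without_isWeilTest` : dropping `IsWeilTest g` ⇒ FALSE (null spike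
    `𝟙_{0}`; landed `windowTraceArch_false_without_isWeilTest`).
  - `spectralThesisComplex_holds` : dropping REALNESS of `γ` (complex spectrum `s_i`, `ĝ(s_i)`) ⇒
    a THEOREM (the non-trivial zeros with multiplicity, landed `hasSum_weilMellin_zeros`), even with
    the spectrum confined to the open critical strip (`spectralThesisStrip_holds`). Realness of the
    spectrum is the ENTIRE content of `X`.
  - `spectralThesis_trivial_without_value` : dropping the VALUE `W g` (mere summability) ⇒ trivially
    true (empty family).
  - `weightedSpectralThesis_iff_riemannHypothesis` : INTEGRALITY (unit masses) is NOT what makes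
    `X` RH-strength: positive real weights `c_i > 0` give a statement again equivalent to RH. The
    integrality content of `X` is exactly the rigidity item `SpectralIsHpSpectrum`, not RH.
* §3 STRUCTURE OF ANY WITNESS (`IsTrace γ`), usable by provers as necessary conditions:
  - `IsTrace.neg` : witnesses are closed under `γ ↦ -γ` (`W` is even: `weilFunctional_comp_neg`).
  - `IsTrace.false_of_le` / `IsTrace.exists_gt` / `IsTrace.exists_lt` / `IsTrace.not_bddAbove` /
    `IsTrace.not_bddBelow` : THE SPECTRUM IS UNBOUNDED ABOVE AND BELOW — no semibounded
    (in particular no positive) Hilbert–Pólya Hamiltonian realises `X`: `not_spectralThesis_bddBelow`,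
    `not_spectralThesis_nonneg`. Proof: test the trace against the DERIVATIVE `k'` of `k = φ ⋆ φ̃`
    (`(k')^(1/2+iγ) = -iγ |φ̂(1/2+iγ)|²`, `weilMellin_deriv`) for the family and for its reflection;
    subtracting gives `Σ_i γ_i (|φ̂(½+iγ_i)|² + |φ̂(½-iγ_i)|²) = 0`, while the Bochner form gives
    `Σ_i (|φ̂(½+iγ_i)|² + |φ̂(½-iγ_i)|²) = 2 Re Q(φ)`; if `γ_i ≤ K` then all but finitely many
    `γ_i ≤ -1` (local finiteness, landed `finite_abs_le_of_windowTrace`), so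
    `2 Re Q(φ) ≤ (K+1)·#F·(thin-support bound 2·2a‖φ‖₂²)`, contradicting Bombieri's coercivity
    `weilQuadratic_coercive` for thin `φ`.
    Corollaries `IsTrace.infinite_setOf_pos`, `IsTrace.infinite_setOf_neg`: infinitely many points
    on EACH half-line.
  - `IsTrace.countable`, `IsTrace.infinite`, `spectralThesis_iff_nat` : WLOG `ι = ℕ` (normal form
    for provers: `X ↔ ∃ γ : ℕ → ℝ, IsTrace γ`).
  - restated from the window rungs (landed): local finiteness `IsTrace.finite_abs_le`, local Weyl
    upper bound `IsTrace.card_near_le_log`, no `δ`-separated witness `IsTrace.not_separated`,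
    Bochner form `IsTrace.hasSum_norm_sq`.
* §4 PARITY (classification of §3's one-sided refutation). `weilFunctional_eq_zero_of_odd` (`W` kills
  odd functions, hypothesis-free) ⇒ `IsTrace.hasSum_zero_of_odd`: every witness satisfies
  `Σ_i ĝ(1/2+iγ_i) = 0` on ODD Weil tests — this is what a one-sided spectrum cannot do.
  `riemannHypothesis_of_even_trace`: reproducing `W` on the EVEN Weil tests alone already proves RH
  (parity splitting `Q(g) = Q(g₊) + Q(g₋)`, `weilQuadratic_eq_evenPart_add_oddPart`);
  `spectralThesisEven_iff_riemannHypothesis : X_even ↔ RH` and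
  `spectralThesisEvenPos_iff_riemannHypothesis : X⁺_even ↔ RH`, where `X⁺_even` asks for a POSITIVE
  spectrum reproducing `W` on even tests (under RH: `|Im ρ|` with multiplicity, levels doubled).
  So the REPAIRED "positive Hamiltonian" statement is again exactly RH: `not_spectralThesis_nonneg`
  bites the literal normalisation of `X` (all tests), not the one-sided mechanism (misstated-type,
  repaired statement `SpectralThesisEvenPos`, which the witness misses).
* §5 FINITE RIGIDITY. `eq_zero_of_sum_weilMellin_eq_zero`: the point evaluations
  `g ↦ ĝ(1/2+iu)` at finitely many distinct real `u` are LINEARLY INDEPENDENT on the Weil tests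
  (induction: test on `g'` and subtract). Hence a witness cannot be patched at finitely many
  points: `IsTrace.not_isTrace_subtype_notMem` (no finite deletion), `IsTrace.not_isTrace_sum_elim`
  (no finite insertion), `IsTrace.not_isTrace_update` (no single move), and in general
  `IsTrace.card_filter_eq_of_agree_off_finset` (two witnesses agreeing off finite sets carry the
  same finite multiset there). Any "quasi-zeros + correction" construction of `X` must correct
  infinitely many points (or none).
* §6 PRIME SIDE. `IsTrace.norm_weilFunctional_weilTranslate_le`, `IsTrace.exists_bound_weilTranslate`:
  a witness forces `sup_T ‖W(g(· - T))‖ ≤ Σ_i |ĝ(1/2+iγ_i)| < ∞` for every Weil test — the smoothed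
  prime number theorem with square-root error (what a counterexample must violate).
  `boundedTranslates_of_complexWeightedSpectralThesis`: even arbitrary COMPLEX weights on a real
  spectrum force bounded translates — neither positivity nor integrality of the spectral measure
  carries RH in `X`, only the realness of its support; `X → X_ℂ-weights → BoundedTranslates`.
* §7 SMALL MODELS / COMPUTATION: none meaningful (§1). Recorded, none run.
* §8 THE CONVERSE, PROVED: `riemannHypothesis_of_forall_bounded_weilTranslate` /
  `riemannHypothesis_of_boundedTranslates` — if `T ↦ W(g(· - T))` is bounded for every Weil test
  then RH (aim a test at an off-line zero `s₀`, `ĝ(s₀) = ∫ b > 0`; the Mellin transform of the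
  bounded function `t ↦ W(g(· + log t))𝟙_{(0,1)}` is holomorphic on `Re z > 0`
  (`mellin_differentiableAt_of_isBigO_rpow`) and equals the partial-fraction series
  `Σ_p ĝ(ρ_p)/(z - (ρ_p - 1/2))` on `Re z > 1`; tail holomorphic on a half-strip around `s₀ - 1/2`,
  clear the finitely many nearby denominators, identity theorem on the convex strip, evaluate at
  `s₀ - 1/2`: `0 = m(s₀) ĝ(s₀) Π(s₀ - ρ') ≠ 0`). Hence `boundedTranslates_iff_riemannHypothesis`,
  `complexWeightedSpectralThesis_iff_riemannHypothesis` and the chain `spectralThesis_tfae`: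
  `X ↔ X_weights>0 ↔ X_ℂ-weights ↔ X_even ↔ X⁺_even ↔ BoundedTranslates ↔ RH`. CONCLUSION OF THE
  LOAD-BEARING ANALYSIS: neither positivity nor integrality of the spectral measure carries RH in
  `X` — only the realness of its support; integrality/positivity carry the rigidity content (0195).
* §9 NEAR-MISSES: none (nothing is sorried). OPEN VARIANT: the symmetric-multiset statement
  `#{i | γ_i = u} = #{i | γ_i = -u}` (needs the rigidity item 0195).
  `-- Targets`: none registered (payload `targets = []`, `stuck_stubs = []`).

## Checklist for constructions (necessary conditions on any witness `γ`, all proved here or landed)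

infinite and countable (WLOG `ℕ`-indexed); locally finite with `#{i : |γ_i - T| ≤ 1} = O(log(2+|T|))`
but NOT uniformly bounded per unit cell, not `δ`-separated, no lattice / finite union of progressions;
unbounded above AND below with infinitely many points on each half-line; `Σ_i |ĝ(½+iγ_i)|² = Re Q(g)`
(Bochner) and `Σ_i ĝ(½+iγ_i) = 0` on odd tests; finitely rigid (no finite deletion / insertion / move;
two witnesses agreeing off finite sets agree there too); `sup_T ‖W(g(· - T))‖ < ∞`. And the family proves
RH, after which it must be the multiset of zero ordinates (rigidity item stmt-0195).
-/

noncomputable section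

set_option linter.dupNamespace false

open Complex Set MeasureTheory Filter Asymptotics

namespace Summit.RiemannHypothesis.RiemannHypothesis.Cruxes.SpectralThesis.Disproof

open Literature.NumberTheory.LFunctions
open Summit.RiemannHypothesis.RiemannHypothesis.Theses.SpectralTrace
open Summit.RiemannHypothesis.RiemannHypothesis.Theorems
open Summit.RiemannHypothesis.RiemannHypothesis.Theorems.WindowTraceArch.Negative
open Summit.RiemannHypothesis.RiemannHypothesis.Theorems.SpectralIsHpSpectrum.Negative

/-! ## §0 Vocabulary -/

/-- `IsTrace γ`: the real family `γ` reproduces the Weil functional on every Weil test — the body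
of the crux `X` at a given family. [folklore] -/
def IsTrace {ι : Type*} (γ : ι → ℝ) : Prop :=
  ∀ g : ℝ → ℂ, IsWeilTest g →
    HasSum (fun i => weilMellin g (1 / 2 + (γ i : ℂ) * I)) (weilFunctional g)

/-- Unfolding: `X ↔ ∃ ι γ, IsTrace γ`. [folklore] -/
theorem spectralThesis_iff : SpectralThesis ↔ ∃ (ι : Type) (γ : ι → ℝ), IsTrace γ := Iff.rfl

/-- A trace family is a window-trace family on every window `[-A, A]`. [folklore] -/
theorem IsTrace.window {ι : Type*} {γ : ι → ℝ} (h : IsTrace γ) (A : ℝ) :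
    ∀ g : ℝ → ℂ, IsWeilTest g → tsupport g ⊆ Icc (-A) A →
      HasSum (fun i => weilMellin g (1 / 2 + (γ i : ℂ) * I)) (weilFunctional g) :=
  fun g hg _ => h g hg

/-! ## §1 Why it resists: `X ↔ RH` -/

/-- Any trace family proves RH (Bochner form of the trace on `g ⋆ g̃` and Weil's criterion;
landed as `riemannHypothesis_of_trace`). [folklore] -/
theorem IsTrace.riemannHypothesis {ι : Type*} {γ : ι → ℝ} (h : IsTrace γ) :
    _root_.RiemannHypothesis :=
  riemannHypothesis_of_trace h

/-- **`X ↔ RH`** (kernel-checked, axioms `propext`, `Classical.choice`, `Quot.sound`). [folklore] -/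
theorem spectralThesis_iff_riemannHypothesis : SpectralThesis ↔ _root_.RiemannHypothesis :=
  ⟨fun ⟨_, _, h⟩ => riemannHypothesis_of_trace h, spectralThesis_of_riemannHypothesis⟩

/-- `X ↔` the summit statement. [folklore] -/
theorem spectralThesis_iff_summit : SpectralThesis ↔ Summit.RiemannHypothesis :=
  spectralThesis_iff_riemannHypothesis.trans Summit.RiemannHypothesis_iff.symm

/-- **A refutation of the crux is a refutation of RH.** [folklore] -/
theorem not_spectralThesis_iff : ¬ SpectralThesis ↔ ¬ _root_.RiemannHypothesis :=
  not_congr spectralThesis_iff_riemannHypothesis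

/-- `X ↔` the whole window ladder (`∀ A > 0, Trace(A)`; landed `windowCompactness_proof`).
[folklore] -/
theorem spectralThesis_iff_ladder :
    SpectralThesis ↔ ∀ A : ℝ, 0 < A → ∃ (ι : Type) (γ : ι → ℝ), ∀ g : ℝ → ℂ, IsWeilTest g →
      tsupport g ⊆ Icc (-A) A →
        HasSum (fun i => weilMellin g (1 / 2 + (γ i : ℂ) * I)) (weilFunctional g) :=
  ⟨fun ⟨ι, γ, h⟩ _ _ => ⟨ι, γ, fun g hg _ => h g hg⟩, fun hl => windowCompactness_proof hl⟩

/-! ## §2 Load-bearing hypotheses -/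

/-- The crux with `IsWeilTest g` DROPPED. [folklore] -/
def SpectralThesisWithoutIsWeilTest : Prop :=
  ∃ (ι : Type) (γ : ι → ℝ), ∀ g : ℝ → ℂ,
    HasSum (fun i => weilMellin g (1 / 2 + (γ i : ℂ) * I)) (weilFunctional g)

/-- **FALSE without `IsWeilTest`** (witness `g = 𝟙_{0}`: all summands `0`, `W g = -log π`).
[folklore] -/
theorem spectralThesis_false_without_isWeilTest : ¬ SpectralThesisWithoutIsWeilTest := by
  rintro ⟨ι, γ, h⟩
  exact windowTraceArch_false_without_isWeilTest ⟨ι, γ, fun g _ => h g⟩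

/-- The crux with REALNESS of the spectrum dropped (complex spectral parameters `s_i`). [folklore] -/
def SpectralThesisComplex : Prop :=
  ∃ (ι : Type) (s : ι → ℂ), ∀ g : ℝ → ℂ, IsWeilTest g →
    HasSum (fun i => weilMellin g (s i)) (weilFunctional g)

/-- **TRUE without realness**: the non-trivial zeros with multiplicity are a complex spectrum
(explicit formula, landed `exists_complex_spectrum`). [folklore] -/
theorem spectralThesisComplex_holds : SpectralThesisComplex := exists_complex_spectrum

/-- **TRUE without realness, spectrum in the open critical strip** `0 < Re s_i < 1`: so what
`X` adds to a theorem is exactly `Re s_i = 1/2`. [folklore] -/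
theorem spectralThesisStrip_holds :
    ∃ (ι : Type) (s : ι → ℂ), (∀ i, 0 < (s i).re ∧ (s i).re < 1) ∧ ∀ g : ℝ → ℂ, IsWeilTest g →
      HasSum (fun i => weilMellin g (s i)) (weilFunctional g) :=
  ⟨(Σ ρ : ZetaZeros.riemannZetaNontrivialZeros, Fin (riemannZetaZeroOrder (ρ : ℂ)).toNat),
    fun p => (p.1 : ℂ),
    fun p => ⟨ZetaZeros.riemannZetaNontrivialZeros.re_pos p.1.2,
      ZetaZeros.riemannZetaNontrivialZeros.re_lt_one p.1.2⟩,
    fun _ hg => hasSum_weilMellin_zeros hg⟩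

/-- **TRIVIAL without the value**: with `HasSum … (W g)` weakened to `Summable`, the empty
family works. [folklore] -/
theorem spectralThesis_trivial_without_value :
    ∃ (ι : Type) (γ : ι → ℝ), ∀ g : ℝ → ℂ, IsWeilTest g →
      Summable (fun i => weilMellin g (1 / 2 + (γ i : ℂ) * I)) :=
  ⟨PEmpty, fun i => i.elim, fun _ _ => summable_empty⟩

/-- The WEIGHTED relaxation: positive real masses `c_i` instead of unit masses. [folklore] -/
def WeightedSpectralThesis : Prop :=
  ∃ (ι : Type) (γ : ι → ℝ) (c : ι → ℝ), (∀ i, 0 < c i) ∧ ∀ g : ℝ → ℂ, IsWeilTest g →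
    HasSum (fun i => (c i : ℂ) * weilMellin g (1 / 2 + (γ i : ℂ) * I)) (weilFunctional g)

/-- **Integrality is not load-bearing for the RH-equivalence**: the weighted relaxation is again
equivalent to RH (positivity needs only `c_i > 0`). [folklore] -/
theorem weightedSpectralThesis_iff_riemannHypothesis :
    WeightedSpectralThesis ↔ _root_.RiemannHypothesis := by
  constructor
  · rintro ⟨ι, γ, c, hc, h⟩
    refine (show _root_.RiemannHypothesis ↔ WeilPositivity from weil_criterion_holds).2
      fun g hg => ?_
    have hk : IsWeilTest (weilConv g (weilReflect g)) := hg.weilConv hg.weilReflect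
    have hs := h _ hk
    have hs' : HasSum (fun i => ((c i * ‖weilMellin g (1 / 2 + (γ i : ℂ) * I)‖ ^ 2 : ℝ) : ℂ))
        (weilQuadratic g) := by
      unfold weilQuadratic
      simpa only [weilMellin_weilConv_weilReflect_half hg, ← Complex.ofReal_mul] using hs
    have hre := hs'.mapL Complex.reCLM
    simp only [Complex.reCLM_apply, Complex.ofReal_re] at hre
    exact hre.nonneg fun i => mul_nonneg (hc i).le (by positivity)
  · intro hRH
    obtain ⟨ι, γ, h⟩ := spectralThesis_of_riemannHypothesis hRH
    exact ⟨ι, γ, fun _ => 1, fun _ => one_pos, fun g hg => by simpa using h g hg⟩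

/-! ## §3 Structure of any witness -/

section Structure

variable {ι : Type*} {γ : ι → ℝ}

/-- Bochner form (landed `hasSum_norm_sq_of_trace`): `Σ_i |ĝ(1/2+iγ_i)|² = Re Q(g)`. [folklore] -/
theorem IsTrace.hasSum_norm_sq (h : IsTrace γ) {g : ℝ → ℂ} (hg : IsWeilTest g) :
    HasSum (fun i => ‖weilMellin g (1 / 2 + (γ i : ℂ) * I)‖ ^ 2) (weilQuadratic g).re :=
  hasSum_norm_sq_of_trace h hg

/-- Every witness is infinite (landed `infinite_of_windowTrace`). [folklore] -/
theorem IsTrace.infinite (h : IsTrace γ) : Infinite ι :=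
  infinite_of_windowTrace one_pos (h.window 1)

/-- Local finiteness (landed `finite_abs_le_of_windowTrace`). [folklore] -/
theorem IsTrace.finite_abs_le (h : IsTrace γ) (R : ℝ) : {i : ι | |γ i| ≤ R}.Finite :=
  finite_abs_le_of_windowTrace one_pos (h.window 1) R

/-- Local Weyl upper bound `O(log T)` points per unit window (landed). [folklore] -/
theorem IsTrace.card_near_le_log (h : IsTrace γ) :
    ∃ C : ℝ, 0 < C ∧ ∀ (T : ℝ) (s : Finset ι), (∀ i ∈ s, |γ i - T| ≤ 1) →
      (s.card : ℝ) ≤ C * (1 + Real.log (1 + |T|)) :=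
  card_near_le_log_of_windowTrace one_pos (h.window 1)

/-- No witness is `δ`-separated (landed `not_separated_of_windowTrace`). [folklore] -/
theorem IsTrace.not_separated (h : IsTrace γ) {δ : ℝ} (hδ : 0 < δ) :
    ¬ Pairwise fun i j => δ ≤ |γ i - γ j| :=
  not_separated_of_windowTrace one_pos (h.window 1) hδ

/-- Every witness is countable (local finiteness). [folklore] -/
theorem IsTrace.countable (h : IsTrace γ) : Countable ι := by
  have hcov : (Set.univ : Set ι) = ⋃ n : ℕ, {i : ι | |γ i| ≤ n} := by
    ext i
    simp only [Set.mem_univ, Set.mem_iUnion, Set.mem_setOf_eq, true_iff]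
    exact ⟨⌈|γ i|⌉₊, Nat.le_ceil _⟩
  have huniv : (Set.univ : Set ι).Countable := by
    rw [hcov]
    exact Set.countable_iUnion fun n => (h.finite_abs_le n).countable
  exact Set.countable_univ_iff.1 huniv

/-- **Normal form: WLOG `ι = ℕ`.** [folklore] -/
theorem spectralThesis_iff_nat : SpectralThesis ↔ ∃ γ : ℕ → ℝ, IsTrace γ := by
  constructor
  · rintro ⟨ι, γ, h⟩
    haveI := IsTrace.countable h
    haveI := IsTrace.infinite h
    obtain ⟨e⟩ : Nonempty (ι ≃ ℕ) := inferInstance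
    refine ⟨γ ∘ e.symm, fun g hg => ?_⟩
    exact (e.symm.hasSum_iff (f := fun i => weilMellin g (1 / 2 + (γ i : ℂ) * I))).2 (h g hg)
  · rintro ⟨γ, h⟩
    exact ⟨ℕ, γ, h⟩

/-- **Reflection symmetry of the witness class**: if `γ` is a trace family, so is `-γ`
(`W(g(-·)) = W(g)`, `weilFunctional_comp_neg`; `(g(-·))^(s) = ĝ(1-s)`, `weilMellin_comp_neg`).
[folklore] -/
theorem IsTrace.neg (h : IsTrace γ) : IsTrace (fun i => -γ i) := by
  intro g hg
  have h1 := h (fun t => g (-t)) hg.comp_neg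
  rw [weilFunctional_comp_neg] at h1
  convert h1 using 2
  rename_i i
  rw [weilMellin_comp_neg]
  congr 1
  push_cast
  ring

/-- **The spectrum of a witness is not bounded above.** See the module docstring for the proof
(derivative test `(φ ⋆ φ̃)'` on the family and its reflection, local finiteness, coercivity).
[folklore] -/
theorem IsTrace.false_of_le (h : IsTrace γ) (K : ℝ) (hK : ∀ i, γ i ≤ K) : False := by
  classical
  -- normalise the bound
  set K' : ℝ := max K 1 with hK'def
  have hKK' : K ≤ K' := le_max_left _ _
  have hK'1 : 1 ≤ K' := le_max_right _ _
  -- the finite exceptional set `F = {i : |γ i| ≤ K'}`; outside it `γ i ≤ -1`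
  have hfin : {i : ι | |γ i| ≤ K'}.Finite := h.finite_abs_le K'
  set F : Finset ι := hfin.toFinset with hFdef
  have hmemF : ∀ i, i ∈ F ↔ |γ i| ≤ K' := fun i => by
    rw [hFdef, Set.Finite.mem_toFinset]
    rfl
  have hout : ∀ i, i ∉ F → γ i ≤ -1 := by
    intro i hi
    rw [hmemF, abs_le, not_and_or, not_le, not_le] at hi
    rcases hi with hi | hi
    · linarith
    · linarith [hK i]
  -- coercivity constant and a thin test on the unit sphere
  set Λ : ℝ := (K' + 1) * F.card + 1 with hΛ
  obtain ⟨a₀, ha₀, hco⟩ := weilQuadratic_coercive Λ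
  set a : ℝ := min a₀ (1 / 2) with ha_def
  have ha : 0 < a := lt_min ha₀ one_half_pos
  have haa₀ : a ≤ a₀ := min_le_left _ _
  have ha2 : a ≤ 1 / 2 := min_le_right _ _
  obtain ⟨φ, hφ, hφs, hφn⟩ := exists_isWeilTest_sphere ha
  have hlow : Λ * ∫ t, ‖φ t‖ ^ 2 ≤ (weilQuadratic φ).re := hco a ha haa₀ φ hφ hφs
  rw [hφn, mul_one] at hlow
  -- the two Bochner weights and their sums
  set u : ι → ℝ := fun i => ‖weilMellin φ (1 / 2 + (γ i : ℂ) * I)‖ ^ 2 with hu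
  set u' : ι → ℝ := fun i => ‖weilMellin φ (1 / 2 + ((-γ i : ℝ) : ℂ) * I)‖ ^ 2 with hu'
  have hsum_u : HasSum u (weilQuadratic φ).re := hasSum_norm_sq_of_trace h hφ
  have hsum_u' : HasSum u' (weilQuadratic φ).re := hasSum_norm_sq_of_trace h.neg hφ
  -- thin support: every weight is at most `2a ≤ 1`
  have hN1 : weilNorm1 φ ^ 2 ≤ 2 * a * weilNorm2Sq φ := weilNorm1_sq_le hφ ha hφs
  have hN2 : weilNorm2Sq φ = 1 := hφn
  have hu_le : ∀ i, u i ≤ 1 := by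
    intro i
    have h3 := norm_weilMellin_half_line_le hφ (γ i)
    have h4 : u i ≤ weilNorm1 φ ^ 2 := pow_le_pow_left₀ (norm_nonneg _) h3 2
    nlinarith
  have hu'_le : ∀ i, u' i ≤ 1 := by
    intro i
    have h3 := norm_weilMellin_half_line_le hφ (-γ i)
    have h4 : u' i ≤ weilNorm1 φ ^ 2 := pow_le_pow_left₀ (norm_nonneg _) h3 2
    nlinarith
  have hu0 : ∀ i, 0 ≤ u i := fun i => by positivity
  have hu'0 : ∀ i, 0 ≤ u' i := fun i => by positivity
  -- the derivative test `k' = (φ ⋆ φ̃)'`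
  set k : ℝ → ℂ := weilConv φ (weilReflect φ) with hk_def
  have hk : IsWeilTest k := hφ.weilConv hφ.weilReflect
  have hk' : IsWeilTest (deriv k) := hk.deriv
  have hderiv : ∀ t : ℝ, weilMellin (deriv k) (1 / 2 + (t : ℂ) * I) =
      -((t : ℂ) * I) * ((‖weilMellin φ (1 / 2 + (t : ℂ) * I)‖ ^ 2 : ℝ) : ℂ) := by
    intro t
    rw [weilMellin_deriv hk, hk_def, weilMellin_weilConv_weilReflect_half hφ t]
    ring
  have h1 : HasSum (fun i => -((γ i : ℂ) * I) * ((u i : ℝ) : ℂ)) (weilFunctional (deriv k)) := by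
    have := h (deriv k) hk'
    simpa only [hderiv] using this
  have h2 : HasSum (fun i => -(((-γ i : ℝ) : ℂ) * I) * ((u' i : ℝ) : ℂ))
      (weilFunctional (deriv k)) := by
    have := h.neg (deriv k) hk'
    simpa only [hderiv] using this
  -- subtract and take imaginary parts: `Σ_i γ_i (u_i + u'_i) = 0`
  have h12 : HasSum (fun i => -((γ i : ℂ) * I) * ((u i : ℝ) : ℂ) -
      -(((-γ i : ℝ) : ℂ) * I) * ((u' i : ℝ) : ℂ)) 0 := by
    have := h1.sub h2
    rwa [sub_self] at this
  have him := h12.mapL Complex.imCLM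
  simp only [Complex.imCLM_apply, map_zero] at him
  have h3 : HasSum (fun i => γ i * (u i + u' i)) 0 := by
    have him' := him.neg
    rw [neg_zero] at him'
    have hfun : (fun i => -(-((γ i : ℂ) * I) * ((u i : ℝ) : ℂ) -
        -(((-γ i : ℝ) : ℂ) * I) * ((u' i : ℝ) : ℂ)).im) = fun i => γ i * (u i + u' i) := by
      funext i
      simp only [Complex.sub_im, Complex.mul_im, Complex.neg_re, Complex.neg_im, Complex.mul_re,
        Complex.ofReal_re, Complex.ofReal_im, Complex.I_re, Complex.I_im, Complex.ofReal_neg]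
      ring
    rw [hfun] at him'
    exact him'
  -- pointwise comparison with a finitely supported majorant
  set v : ι → ℝ := fun i => u i + u' i with hv
  have hv0 : ∀ i, 0 ≤ v i := fun i => add_nonneg (hu0 i) (hu'0 i)
  have hsum_v : HasSum v (2 * (weilQuadratic φ).re) := by
    have := hsum_u.add hsum_u'
    rwa [← two_mul] at this
  set w : ι → ℝ := fun i => if i ∈ F then v i else 0 with hw
  have hsum_w : HasSum w (∑ i ∈ F, v i) := by
    have hw0 : ∀ i ∉ F, w i = 0 := fun i hi => if_neg hi
    have this : HasSum w (∑ i ∈ F, w i) := hasSum_sum_of_ne_finset_zero hw0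
    rwa [Finset.sum_congr rfl (fun i hi => (if_pos hi : w i = v i))] at this
  have hpt : ∀ i, γ i * v i ≤ (K' + 1) * w i - v i := by
    intro i
    by_cases hi : i ∈ F
    · have hwi : w i = v i := if_pos hi
      rw [hwi]
      have : γ i ≤ K' := (hK i).trans hKK'
      nlinarith [hv0 i]
    · have hwi : w i = 0 := if_neg hi
      rw [hwi]
      have := hout i hi
      nlinarith [hv0 i]
  have hle : (0 : ℝ) ≤ (K' + 1) * (∑ i ∈ F, v i) - 2 * (weilQuadratic φ).re :=
    hasSum_le hpt h3 ((hsum_w.mul_left (K' + 1)).sub hsum_v)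
  -- the finite sum is at most `2 · #F`
  have hFsum : ∑ i ∈ F, v i ≤ F.card * 2 := by
    calc ∑ i ∈ F, v i ≤ ∑ _i ∈ F, (2 : ℝ) := Finset.sum_le_sum fun i _ => by
            have := hu_le i
            have := hu'_le i
            show u i + u' i ≤ 2
            linarith
      _ = F.card * 2 := by rw [Finset.sum_const, nsmul_eq_mul]
  have hmul : (K' + 1) * (∑ i ∈ F, v i) ≤ (K' + 1) * (F.card * 2) :=
    mul_le_mul_of_nonneg_left hFsum (by linarith)
  -- contradiction with coercivity `Λ = (K'+1) #F + 1 ≤ Re Q(φ)`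
  have hP : (K' + 1) * ((F.card : ℝ) * 2) = 2 * ((K' + 1) * F.card) := by ring
  rw [hP] at hmul
  linarith

/-- Unbounded above: some point exceeds any `K`. [folklore] -/
theorem IsTrace.exists_gt (h : IsTrace γ) (K : ℝ) : ∃ i, K < γ i := by
  by_contra hK
  exact h.false_of_le K fun i => le_of_not_gt fun hi => hK ⟨i, hi⟩

/-- Unbounded below: some point is below any `K` (reflection + `exists_gt`). [folklore] -/
theorem IsTrace.exists_lt (h : IsTrace γ) (K : ℝ) : ∃ i, γ i < K := by
  obtain ⟨i, hi⟩ := h.neg.exists_gt (-K)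
  exact ⟨i, by linarith⟩

/-- The range of a witness is not bounded above. [folklore] -/
theorem IsTrace.not_bddAbove (h : IsTrace γ) : ¬ BddAbove (Set.range γ) := by
  rintro ⟨K, hK⟩
  obtain ⟨i, hi⟩ := h.exists_gt K
  exact not_le.2 hi (hK ⟨i, rfl⟩)

/-- The range of a witness is not bounded below. [folklore] -/
theorem IsTrace.not_bddBelow (h : IsTrace γ) : ¬ BddBelow (Set.range γ) := by
  rintro ⟨K, hK⟩
  obtain ⟨i, hi⟩ := h.exists_lt K
  exact not_le.2 hi (hK ⟨i, rfl⟩)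

/-- Infinitely many points on the positive half-line. [folklore] -/
theorem IsTrace.infinite_setOf_pos (h : IsTrace γ) : {i : ι | 0 < γ i}.Infinite := by
  intro hfin
  obtain ⟨M, hM⟩ := (hfin.image γ).bddAbove
  refine h.false_of_le (max M 0) fun i => ?_
  by_cases hi : 0 < γ i
  · exact (hM ⟨i, hi, rfl⟩).trans (le_max_left _ _)
  · exact (not_lt.1 hi).trans (le_max_right _ _)

/-- Infinitely many points on the negative half-line. [folklore] -/
theorem IsTrace.infinite_setOf_neg (h : IsTrace γ) : {i : ι | γ i < 0}.Infinite := by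
  have := h.neg.infinite_setOf_pos
  simpa using this

end Structure

/-- **No semibounded Hilbert–Pólya spectrum**: no real family bounded below reproduces `W`.
[folklore] -/
theorem not_spectralThesis_bddBelow :
    ¬ ∃ (ι : Type) (γ : ι → ℝ), BddBelow (Set.range γ) ∧ IsTrace γ :=
  fun ⟨_, _, hb, h⟩ => h.not_bddBelow hb

/-- No real family bounded above reproduces `W`. [folklore] -/
theorem not_spectralThesis_bddAbove :
    ¬ ∃ (ι : Type) (γ : ι → ℝ), BddAbove (Set.range γ) ∧ IsTrace γ :=
  fun ⟨_, _, hb, h⟩ => h.not_bddAbove hb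

/-- In particular the "positive energy levels only" strengthening of `X` is FALSE: the
ordinates `γ_n > 0` alone (a positive Hamiltonian) never reproduce `W` on all Weil tests.
[folklore] -/
theorem not_spectralThesis_nonneg :
    ¬ ∃ (ι : Type) (γ : ι → ℝ), (∀ i, 0 ≤ γ i) ∧ IsTrace γ :=
  fun ⟨_, γ, h0, h⟩ => h.not_bddBelow ⟨0, by rintro _ ⟨i, rfl⟩; exact h0 i⟩

/-! ## §4 Parity: odd tests, even tests, and the repaired one-sided statement -/

section Parity

variable {ι : Type*} {γ : ι → ℝ}

/-- `W` vanishes on ODD functions (hypothesis-free: `W(g(-·)) = W(g)` and `W(-g) = -W(g)`).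
[folklore] -/
theorem weilFunctional_eq_zero_of_odd {g : ℝ → ℂ} (ho : ∀ t, g (-t) = -g t) :
    weilFunctional g = 0 := by
  have h1 : (fun t => g (-t)) = fun t => (-1 : ℂ) * g t := funext fun t => by rw [ho, neg_one_mul]
  have h := weilFunctional_comp_neg g
  rw [h1, weilFunctional_const_mul] at h
  linear_combination (-1 / 2 : ℂ) * h

/-- For a trace family, `Σ_i ĝ(1/2 + iγ_i) = 0` for every ODD Weil test `g` — the constraint a
one-sided spectrum cannot meet. [folklore] -/
theorem IsTrace.hasSum_zero_of_odd (h : IsTrace γ) {g : ℝ → ℂ} (hg : IsWeilTest g)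
    (ho : ∀ t, g (-t) = -g t) :
    HasSum (fun i => weilMellin g (1 / 2 + (γ i : ℂ) * I)) 0 := by
  simpa only [weilFunctional_eq_zero_of_odd ho] using h g hg

/-- For an EVEN function, `ĝ(1/2 - iu) = ĝ(1/2 + iu)`. [folklore] -/
theorem weilMellin_half_neg_of_even {g : ℝ → ℂ} (he : ∀ t, g (-t) = g t) (u : ℝ) :
    weilMellin g (1 / 2 + ((-u : ℝ) : ℂ) * I) = weilMellin g (1 / 2 + (u : ℂ) * I) := by
  have h1 : (fun t => g (-t)) = g := funext he
  have h := weilMellin_comp_neg g (1 / 2 + (u : ℂ) * I)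
  rw [h1] at h
  rw [h]
  congr 1
  push_cast
  ring

/-- `f ⋆ f̃` is even when `f` is even. [folklore] -/
theorem even_weilConv_weilReflect_of_even {f : ℝ → ℂ} (he : ∀ t, f (-t) = f t) (t : ℝ) :
    weilConv f (weilReflect f) (-t) = weilConv f (weilReflect f) t := by
  have h1 : (fun t => f (-t)) = f := funext he
  have h2 : (fun t => weilConv f (weilReflect f) (-t)) = weilConv f (weilReflect f) := by
    rw [← weilConv_comp_neg, ← weilReflect_comp_neg, h1]
  exact congrFun h2 t

/-- `f ⋆ f̃` is even when `f` is odd. [folklore] -/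
theorem even_weilConv_weilReflect_of_odd {f : ℝ → ℂ} (ho : ∀ t, f (-t) = -f t) (t : ℝ) :
    weilConv f (weilReflect f) (-t) = weilConv f (weilReflect f) t := by
  have h1 : (fun t => f (-t)) = fun t => (-1 : ℂ) * f t := funext fun t => by rw [ho, neg_one_mul]
  have h2 : (fun t => weilConv f (weilReflect f) (-t)) = weilConv f (weilReflect f) := by
    rw [← weilConv_comp_neg, ← weilReflect_comp_neg, h1, weilReflect_const_mul, map_neg, map_one,
      weilConv_const_mul_right, weilConv_const_mul_left]
    funext t
    beta_reduce
    ring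
  exact congrFun h2 t

/-- **A family reproducing `W` on the EVEN Weil tests already proves RH**: `Q(g) = Q(g₊) + Q(g₋)`
(parity splitting, `weilQuadratic_eq_evenPart_add_oddPart`), and `g± ⋆ (g±)̃` are even kernels
on which the Bochner form applies. [folklore] -/
theorem riemannHypothesis_of_even_trace
    (h : ∀ g : ℝ → ℂ, IsWeilTest g → (∀ t, g (-t) = g t) →
      HasSum (fun i => weilMellin g (1 / 2 + (γ i : ℂ) * I)) (weilFunctional g)) :
    _root_.RiemannHypothesis := by
  refine (show _root_.RiemannHypothesis ↔ WeilPositivity from weil_criterion_holds).2 fun g hg => ?_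
  have key : ∀ f : ℝ → ℂ, IsWeilTest f →
      (∀ t, weilConv f (weilReflect f) (-t) = weilConv f (weilReflect f) t) →
        0 ≤ (weilQuadratic f).re := by
    intro f hf hev
    have hk : IsWeilTest (weilConv f (weilReflect f)) := hf.weilConv hf.weilReflect
    have hs := h _ hk hev
    have hs' : HasSum (fun i => ((‖weilMellin f (1 / 2 + (γ i : ℂ) * I)‖ ^ 2 : ℝ) : ℂ))
        (weilQuadratic f) := by
      unfold weilQuadratic
      simpa only [weilMellin_weilConv_weilReflect_half hf] using hs
    have hre := hs'.mapL Complex.reCLM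
    simp only [Complex.reCLM_apply, Complex.ofReal_re] at hre
    exact hre.nonneg fun i => by positivity
  rw [weilQuadratic_eq_evenPart_add_oddPart hg, Complex.add_re]
  refine add_nonneg (key _ hg.evenPart (even_weilConv_weilReflect_of_even fun t => ?_))
    (key _ hg.oddPart (even_weilConv_weilReflect_of_odd fun t => ?_))
  · simp only [neg_neg]
    ring
  · simp only [neg_neg]
    ring

/-- `X` with the tests restricted to EVEN Weil tests. [folklore] -/
def SpectralThesisEven : Prop :=
  ∃ (ι : Type) (γ : ι → ℝ), ∀ g : ℝ → ℂ, IsWeilTest g → (∀ t, g (-t) = g t) →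
    HasSum (fun i => weilMellin g (1 / 2 + (γ i : ℂ) * I)) (weilFunctional g)

/-- The REPAIRED one-sided statement: a POSITIVE spectrum reproducing `W` on the even Weil tests
("positive energy levels", each level then standing for the pair `±γ`). [folklore] -/
def SpectralThesisEvenPos : Prop :=
  ∃ (ι : Type) (γ : ι → ℝ), (∀ i, 0 < γ i) ∧ ∀ g : ℝ → ℂ, IsWeilTest g → (∀ t, g (-t) = g t) →
    HasSum (fun i => weilMellin g (1 / 2 + (γ i : ℂ) * I)) (weilFunctional g)

/-- Non-trivial zeros are non-real (no zeros of `ζ` on the real segment `(0, 1)`). [folklore] -/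
theorem im_ne_zero (ρ : ZetaZeros.riemannZetaNontrivialZeros) : (ρ : ℂ).im ≠ 0 := fun him =>
  riemannZeta_ne_zero_of_im_eq_zero_of_pos_of_lt_one him
    (ZetaZeros.riemannZetaNontrivialZeros.re_pos ρ.2)
    (ZetaZeros.riemannZetaNontrivialZeros.re_lt_one ρ.2)
    (ZetaZeros.riemannZetaNontrivialZeros.zeta_eq_zero ρ.2)

/-- `RH → X⁺_even`: under RH the absolute ordinates `|Im ρ|`, with multiplicity (so every level is
doubled, `ρ` and `ρ̄`), reproduce `W` on even tests. [folklore] -/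
theorem spectralThesisEvenPos_of_riemannHypothesis (hRH : _root_.RiemannHypothesis) :
    SpectralThesisEvenPos := by
  refine ⟨(Σ ρ : ZetaZeros.riemannZetaNontrivialZeros, Fin (riemannZetaZeroOrder (ρ : ℂ)).toNat),
    fun p => |(p.1 : ℂ).im|, fun p => abs_pos.2 (im_ne_zero p.1), fun g hg hev => ?_⟩
  have h := hasSum_weilMellin_zeros hg
  convert h using 2
  rename_i p
  dsimp only
  conv_rhs => rw [← eq_half_add_of_riemannHypothesis hRH p.1]
  rcases le_or_gt 0 ((p.1 : ℂ).im) with hp | hp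
  · rw [abs_of_nonneg hp]
  · rw [abs_of_neg hp, weilMellin_half_neg_of_even hev]

/-- **`X_even ↔ RH`**: testing even functions only is already RH-strength. [folklore] -/
theorem spectralThesisEven_iff_riemannHypothesis : SpectralThesisEven ↔ _root_.RiemannHypothesis :=
  ⟨fun ⟨_, _, h⟩ => riemannHypothesis_of_even_trace h, fun hRH => by
    obtain ⟨ι, γ, -, h⟩ := spectralThesisEvenPos_of_riemannHypothesis hRH
    exact ⟨ι, γ, h⟩⟩

/-- **`X⁺_even ↔ RH`**: the repaired "positive Hamiltonian" statement is again exactly RH — so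
`not_spectralThesis_nonneg` refutes only the literal normalisation of `X` (odd tests force
`Σ_i ĝ(1/2+iγ_i) = 0`, `IsTrace.hasSum_zero_of_odd`), not the one-sided mechanism. [folklore] -/
theorem spectralThesisEvenPos_iff_riemannHypothesis :
    SpectralThesisEvenPos ↔ _root_.RiemannHypothesis :=
  ⟨fun ⟨_, _, _, h⟩ => riemannHypothesis_of_even_trace h, spectralThesisEvenPos_of_riemannHypothesis⟩

/-- `X ↔ X⁺_even`. [folklore] -/
theorem spectralThesis_iff_spectralThesisEvenPos : SpectralThesis ↔ SpectralThesisEvenPos :=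
  spectralThesis_iff_riemannHypothesis.trans spectralThesisEvenPos_iff_riemannHypothesis.symm

end Parity

/-! ## §5 Finite rigidity: a witness cannot be patched at finitely many points -/

section Rigidity

variable {ι : Type*} {γ : ι → ℝ}

/-- For every real `u` some Weil test has `ĝ(1/2 + iu) ≠ 0` (a narrow bump modulated to `u`;
landed `exists_bump_lower`, `weilMellin_modulate`). [folklore] -/
theorem exists_weilMellin_ne_zero (u : ℝ) :
    ∃ g : ℝ → ℂ, IsWeilTest g ∧ weilMellin g (1 / 2 + (u : ℂ) * I) ≠ 0 := by
  obtain ⟨h, hh, -, -, c, hc, hlow⟩ := exists_bump_lower (δ := 1 / 2) one_half_pos le_rfl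
  refine ⟨fun t => cexp (-((u * t : ℝ) : ℂ) * I) * h t, isWeilTest_modulate hh u, ?_⟩
  rw [weilMellin_modulate h u u]
  intro h0
  have h1 := hlow (u - u) (by simp)
  rw [h0, norm_zero, zero_pow two_ne_zero] at h1
  linarith

/-- **Point evaluations `g ↦ ĝ(1/2 + iu)` at finitely many distinct real `u` are linearly
independent functionals on the Weil tests.** Induction on the finite set: testing the relation on
`g'` (`(g')^(1/2+iu) = -iu ĝ(1/2+iu)`, `weilMellin_deriv`) and subtracting `a`-times the relation
kills the node `a` and twists the other coefficients by `u - a ≠ 0`. [folklore] -/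
theorem eq_zero_of_sum_weilMellin_eq_zero (J : Finset ℝ) (c : ℝ → ℂ)
    (h : ∀ g : ℝ → ℂ, IsWeilTest g →
      ∑ u ∈ J, c u * weilMellin g (1 / 2 + (u : ℂ) * I) = 0) :
    ∀ u ∈ J, c u = 0 := by
  classical
  induction J using Finset.induction_on generalizing c with
  | empty => simp
  | insert a s ha ih =>
    -- the twisted coefficients `c u * (u - a)` satisfy the relation on `s`
    have h' : ∀ g : ℝ → ℂ, IsWeilTest g →
        ∑ u ∈ s, (c u * ((u : ℂ) - a)) * weilMellin g (1 / 2 + (u : ℂ) * I) = 0 := by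
      intro g hg
      have h1 := h g hg
      have h2 := h (deriv g) hg.deriv
      simp only [weilMellin_deriv hg] at h2
      rw [Finset.sum_insert ha] at h1 h2
      have hpt : ∀ u : ℝ, (c u * ((u : ℂ) - a)) * weilMellin g (1 / 2 + (u : ℂ) * I) =
          I * (c u * (-(1 / 2 + (u : ℂ) * I - 1 / 2) * weilMellin g (1 / 2 + (u : ℂ) * I))) -
            (a : ℂ) * (c u * weilMellin g (1 / 2 + (u : ℂ) * I)) := fun u => by
        linear_combination ((u : ℂ) * c u * weilMellin g (1 / 2 + (u : ℂ) * I)) * Complex.I_mul_I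
      rw [Finset.sum_congr rfl (fun u _ => hpt u), Finset.sum_sub_distrib, ← Finset.mul_sum,
        ← Finset.mul_sum]
      have e1 : ∑ u ∈ s, c u * weilMellin g (1 / 2 + (u : ℂ) * I) =
          -(c a * weilMellin g (1 / 2 + (a : ℂ) * I)) := by
        linear_combination h1
      have e2 : ∑ u ∈ s, c u * (-(1 / 2 + (u : ℂ) * I - 1 / 2) * weilMellin g (1 / 2 + (u : ℂ) * I)) =
          -(c a * (-(1 / 2 + (a : ℂ) * I - 1 / 2) * weilMellin g (1 / 2 + (a : ℂ) * I))) := by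
        linear_combination h2
      rw [e1, e2]
      linear_combination ((a : ℂ) * c a * weilMellin g (1 / 2 + (a : ℂ) * I)) * Complex.I_mul_I
    -- by induction they vanish, hence `c` vanishes on `s`
    have hs : ∀ u ∈ s, c u = 0 := by
      intro u hu
      have h0 := ih (fun u => c u * ((u : ℂ) - a)) h' u hu
      have hne : (u : ℂ) - a ≠ 0 :=
        sub_ne_zero.2 (by exact_mod_cast ne_of_mem_of_not_mem hu ha)
      exact (mul_eq_zero.1 h0).resolve_right hne
    -- the relation reduces to `c a * ĝ(a) = 0` for all `g`
    intro u hu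
    rcases Finset.mem_insert.1 hu with hua | hu'
    · rw [hua]
      obtain ⟨g, hg, hga⟩ := exists_weilMellin_ne_zero a
      have h1 := h g hg
      rw [Finset.sum_insert ha,
        Finset.sum_eq_zero (fun v hv => by rw [hs v hv, zero_mul]), add_zero] at h1
      exact (mul_eq_zero.1 h1).resolve_right hga
    · exact hs u hu'

/-- For a trace family and a finite set `A` of indices, `Σ_{i ∈ A} ĝ(1/2+iγ_i) = 0` for all Weil
`g` is impossible unless `A = ∅` (group by values and use linear independence). [folklore] -/
theorem finset_eq_empty_of_sum_weilMellin_eq_zero (A : Finset ι)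
    (h : ∀ g : ℝ → ℂ, IsWeilTest g → ∑ i ∈ A, weilMellin g (1 / 2 + (γ i : ℂ) * I) = 0) :
    A = ∅ := by
  classical
  by_contra hA
  obtain ⟨i₀, hi₀⟩ := Finset.nonempty_iff_ne_empty.2 hA
  have hind := eq_zero_of_sum_weilMellin_eq_zero (A.image γ)
    (fun u => ((A.filter (fun i => γ i = u)).card : ℂ)) (fun g hg => by
      refine Eq.trans ?_ (h g hg)
      rw [← Finset.sum_fiberwise_of_maps_to (fun i hi => Finset.mem_image_of_mem γ hi)]
      refine Finset.sum_congr rfl fun u _ => ?_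
      rw [Finset.sum_congr rfl (fun i hi => by rw [(Finset.mem_filter.1 hi).2]), Finset.sum_const,
        nsmul_eq_mul])
  have h0 := hind (γ i₀) (Finset.mem_image_of_mem γ hi₀)
  have hpos : 0 < (A.filter (fun i => γ i = γ i₀)).card :=
    Finset.card_pos.2 ⟨i₀, Finset.mem_filter.2 ⟨hi₀, rfl⟩⟩
  exact absurd h0 (by exact_mod_cast hpos.ne')

/-- **No finite deletion**: removing a non-empty finite set of points from a witness never gives a
witness. [folklore] -/
theorem IsTrace.not_isTrace_subtype_notMem (h : IsTrace γ) (A : Finset ι) (hA : A.Nonempty) :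
    ¬ IsTrace (fun i : {i // i ∉ A} => γ i) := by
  intro h'
  refine hA.ne_empty (finset_eq_empty_of_sum_weilMellin_eq_zero (γ := γ) A fun g hg => ?_)
  have h1 := h g hg
  have h2 := (Finset.hasSum_compl_iff (f := fun i => weilMellin g (1 / 2 + (γ i : ℂ) * I)) A).1
    (h' g hg)
  have h3 := h1.unique h2
  linear_combination -h3

/-- **No finite insertion**: adding finitely many (at least one) points to a witness never gives a
witness. [folklore] -/
theorem IsTrace.not_isTrace_sum_elim (h : IsTrace γ) {m : ℕ} (hm : 0 < m) (δ : Fin m → ℝ) :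
    ¬ IsTrace (Sum.elim γ δ) := by
  intro h'
  classical
  have key := finset_eq_empty_of_sum_weilMellin_eq_zero (γ := Sum.elim γ δ)
    ((Finset.univ : Finset (Fin m)).map ⟨Sum.inr, Sum.inr_injective⟩) (fun g hg => ?_)
  · rw [Finset.map_eq_empty, Finset.univ_eq_empty_iff] at key
    exact key.false ⟨0, hm⟩
  · -- the sum over the whole Sum type splits: `W g = W g + Σ_{Fin m}`
    have h1 := h' g hg
    have hl : HasSum (fun i : ι => weilMellin g (1 / 2 + ((Sum.elim γ δ (Sum.inl i) : ℝ) : ℂ) * I))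
        (weilFunctional g) := h g hg
    have hr : HasSum (fun j : Fin m => weilMellin g (1 / 2 + ((Sum.elim γ δ (Sum.inr j) : ℝ) : ℂ) * I))
        (∑ j, weilMellin g (1 / 2 + ((δ j : ℝ) : ℂ) * I)) := hasSum_fintype _
    have h2 := HasSum.sum
      (f := fun x => weilMellin g (1 / 2 + ((Sum.elim γ δ x : ℝ) : ℂ) * I)) hl hr
    have h3 := h1.unique h2
    rw [Finset.sum_map]
    simp only [Function.Embedding.coeFn_mk, Sum.elim_inr]
    linear_combination -h3

/-- **No finite move**: changing the value of a witness at one index (to a different value) never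
gives a witness. [folklore] -/
theorem IsTrace.not_isTrace_update [DecidableEq ι] (h : IsTrace γ) (i₀ : ι) {v : ℝ}
    (hv : v ≠ γ i₀) : ¬ IsTrace (Function.update γ i₀ v) := by
  intro h'
  -- `ĝ(1/2+iv) - ĝ(1/2+iγ_{i₀}) = 0` for every Weil test
  have hsum : ∀ g : ℝ → ℂ, IsWeilTest g →
      weilMellin g (1 / 2 + (v : ℂ) * I) - weilMellin g (1 / 2 + (γ i₀ : ℂ) * I) = 0 := by
    intro g hg
    have h1 := (h g hg).update i₀ (weilMellin g (1 / 2 + (v : ℂ) * I))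
    have h2 := h' g hg
    have hfun : (fun i => weilMellin g (1 / 2 + ((Function.update γ i₀ v i : ℝ) : ℂ) * I)) =
        Function.update (fun i => weilMellin g (1 / 2 + (γ i : ℂ) * I)) i₀
          (weilMellin g (1 / 2 + (v : ℂ) * I)) := by
      funext i
      exact Function.apply_update (α := fun _ => ℝ) (β := fun _ => ℂ)
        (fun _ (x : ℝ) => weilMellin g (1 / 2 + (x : ℂ) * I)) γ i₀ v i
    rw [hfun] at h2
    have h3 := h2.unique h1
    linear_combination -h3
  -- linear independence on the two-point set `{v, γ i₀}`
  have hind := eq_zero_of_sum_weilMellin_eq_zero {v, γ i₀}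
    (fun u => if u = v then 1 else -1) (fun g hg => by
      rw [Finset.sum_pair hv, if_pos rfl, if_neg (Ne.symm hv), one_mul, neg_one_mul, ← sub_eq_add_neg]
      exact hsum g hg)
  have := hind v (Finset.mem_insert_self _ _)
  simp at this

/-- **General finite rigidity**: two witnesses that agree outside finite index sets `A`, `A'`
(through a bijection of the complements) carry the SAME finite multiset on `A` and `A'`.
[folklore] -/
theorem IsTrace.card_filter_eq_of_agree_off_finset {ι' : Type*} {γ' : ι' → ℝ}
    (h : IsTrace γ) (h' : IsTrace γ') (A : Finset ι) (A' : Finset ι')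
    (e : {i // i ∉ A} ≃ {i' // i' ∉ A'}) (he : ∀ i, γ' (e i) = γ i) (u : ℝ) :
    (A.filter (fun i => γ i = u)).card = (A'.filter (fun i' => γ' i' = u)).card := by
  classical
  -- the two finite sums agree on every Weil test
  have hS : ∀ g : ℝ → ℂ, IsWeilTest g →
      ∑ i ∈ A, weilMellin g (1 / 2 + (γ i : ℂ) * I) =
        ∑ i' ∈ A', weilMellin g (1 / 2 + (γ' i' : ℂ) * I) := by
    intro g hg
    set f : ι → ℂ := fun i => weilMellin g (1 / 2 + (γ i : ℂ) * I) with hf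
    set f' : ι' → ℂ := fun i' => weilMellin g (1 / 2 + (γ' i' : ℂ) * I) with hf'
    have h1 : HasSum (fun x : {x // x ∉ A} => f x) (weilFunctional g - ∑ i ∈ A, f i) :=
      (Finset.hasSum_compl_iff A).2 (by rw [sub_add_cancel]; exact h g hg)
    have h2 : HasSum (fun x : {x // x ∉ A'} => f' x) (weilFunctional g - ∑ i' ∈ A', f' i') :=
      (Finset.hasSum_compl_iff A').2 (by rw [sub_add_cancel]; exact h' g hg)
    have h3 : HasSum ((fun x : {x // x ∉ A'} => f' x) ∘ e) (weilFunctional g - ∑ i' ∈ A', f' i') :=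
      (e.hasSum_iff).2 h2
    have hfe : ((fun x : {x // x ∉ A'} => f' x) ∘ e) = fun x : {x // x ∉ A} => f x := by
      funext x
      simp only [Function.comp_apply, hf, hf', he]
    rw [hfe] at h3
    have h4 := h1.unique h3
    linear_combination -h4
  -- group by values on `J` and apply linear independence
  set J : Finset ℝ := A.image γ ∪ A'.image γ' with hJ
  have eA : ∀ g : ℝ → ℂ, ∑ v ∈ J, ((A.filter (fun i => γ i = v)).card : ℂ) *
      weilMellin g (1 / 2 + (v : ℂ) * I) = ∑ i ∈ A, weilMellin g (1 / 2 + (γ i : ℂ) * I) := by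
    intro g
    rw [← Finset.sum_fiberwise_of_maps_to (fun i hi =>
      (Finset.mem_union_left _ (Finset.mem_image_of_mem γ hi) : γ i ∈ J))]
    refine Finset.sum_congr rfl fun v _ => ?_
    rw [Finset.sum_congr rfl (fun i hi => by rw [(Finset.mem_filter.1 hi).2]), Finset.sum_const,
      nsmul_eq_mul]
  have eA' : ∀ g : ℝ → ℂ, ∑ v ∈ J, ((A'.filter (fun i' => γ' i' = v)).card : ℂ) *
      weilMellin g (1 / 2 + (v : ℂ) * I) = ∑ i' ∈ A', weilMellin g (1 / 2 + (γ' i' : ℂ) * I) := by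
    intro g
    rw [← Finset.sum_fiberwise_of_maps_to (fun i hi =>
      (Finset.mem_union_right _ (Finset.mem_image_of_mem γ' hi) : γ' i ∈ J))]
    refine Finset.sum_congr rfl fun v _ => ?_
    rw [Finset.sum_congr rfl (fun i hi => by rw [(Finset.mem_filter.1 hi).2]), Finset.sum_const,
      nsmul_eq_mul]
  have hind := eq_zero_of_sum_weilMellin_eq_zero J
    (fun v => ((A.filter (fun i => γ i = v)).card : ℂ) - ((A'.filter (fun i' => γ' i' = v)).card : ℂ))
    (fun g hg => by
      simp only [sub_mul, Finset.sum_sub_distrib]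
      rw [eA, eA', hS g hg, sub_self])
  by_cases hu : u ∈ J
  · have h0 := hind u hu
    exact_mod_cast sub_eq_zero.1 h0
  · have hA0 : A.filter (fun i => γ i = u) = ∅ := Finset.filter_eq_empty_iff.2 fun i hi hiu =>
      hu (Finset.mem_union_left _ (Finset.mem_image.2 ⟨i, hi, hiu⟩))
    have hA'0 : A'.filter (fun i' => γ' i' = u) = ∅ := Finset.filter_eq_empty_iff.2 fun i hi hiu =>
      hu (Finset.mem_union_right _ (Finset.mem_image.2 ⟨i, hi, hiu⟩))
    rw [hA0, hA'0, Finset.card_empty, Finset.card_empty]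

end Rigidity

/-! ## §6 The prime side: bounded translates (smoothed square-root error term) -/

section Translates

variable {ι : Type*} {γ : ι → ℝ}

/-- **`X` forces bounded translates**: for a witness and a Weil test `g`,
`‖W(g(· - T))‖ ≤ Σ_i |ĝ(1/2+iγ_i)|` for EVERY real `T` (`(g(· - T))^(s) = e^{(s-1/2)T} ĝ(s)`,
`weilMellin_weilTranslate`, unimodular on the critical line). Since
`W(g(· - T)) = e^{T/2} ĝ(1) + e^{-T/2} ĝ(0) - Σ_n Λ(n) n^{-1/2} (g(log n - T) + g(-log n - T)) + W_∞`,
this is a smoothed prime number theorem with square-root error — the face of RH on the prime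
side; a counterexample to `X` must make some `T ↦ W(g(· - T))` unbounded (a pole of its Laplace
transform at `ρ - 1/2`, `Re ρ > 1/2`). [folklore] -/
theorem IsTrace.norm_weilFunctional_weilTranslate_le (h : IsTrace γ) {g : ℝ → ℂ}
    (hg : IsWeilTest g) (T : ℝ) :
    ‖weilFunctional (weilTranslate g T)‖ ≤ ∑' i, ‖weilMellin g (1 / 2 + (γ i : ℂ) * I)‖ := by
  have hT := h (weilTranslate g T) (hg.weilTranslate T)
  simp only [weilMellin_weilTranslate] at hT
  have hsumm : Summable fun i => ‖weilMellin g (1 / 2 + (γ i : ℂ) * I)‖ :=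
    summable_norm_iff.2 (h g hg).summable
  have hnorm : ∀ i, ‖cexp ((1 / 2 + (γ i : ℂ) * I - 1 / 2) * (T : ℂ)) *
      weilMellin g (1 / 2 + (γ i : ℂ) * I)‖ = ‖weilMellin g (1 / 2 + (γ i : ℂ) * I)‖ := by
    intro i
    rw [norm_mul, show (1 / 2 + (γ i : ℂ) * I - 1 / 2) * (T : ℂ) = ((γ i * T : ℝ) : ℂ) * I by
      push_cast; ring, Complex.norm_exp_ofReal_mul_I, one_mul]
  rw [← hT.tsum_eq]
  refine (norm_tsum_le_tsum_norm ?_).trans (le_of_eq (tsum_congr hnorm))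
  exact hsumm.congr fun i => (hnorm i).symm

/-- Uniform bound: `sup_T ‖W(g(· - T))‖ < ∞` for every Weil test `g`. [folklore] -/
theorem IsTrace.exists_bound_weilTranslate (h : IsTrace γ) {g : ℝ → ℂ} (hg : IsWeilTest g) :
    ∃ C : ℝ, ∀ T : ℝ, ‖weilFunctional (weilTranslate g T)‖ ≤ C :=
  ⟨_, fun T => h.norm_weilFunctional_weilTranslate_le hg T⟩

/-- `BoundedTranslates`: for every Weil test `g`, `T ↦ W(g(· - T))` is bounded on `ℝ` (the
smoothed square-root error term in the prime number theorem, for every smooth weight). [folklore] -/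
def BoundedTranslates : Prop :=
  ∀ g : ℝ → ℂ, IsWeilTest g → ∃ C : ℝ, ∀ T : ℝ, ‖weilFunctional (weilTranslate g T)‖ ≤ C

/-- `X → BoundedTranslates`. [folklore] -/
theorem boundedTranslates_of_spectralThesis (h : SpectralThesis) : BoundedTranslates :=
  fun _ hg => by
    obtain ⟨ι, γ, hγ⟩ := h
    exact IsTrace.exists_bound_weilTranslate hγ hg

/-- The relaxation of `X` with arbitrary COMPLEX weights on a real spectrum (no positivity, no
integrality; only realness of the support). [folklore] -/
def ComplexWeightedSpectralThesis : Prop :=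
  ∃ (ι : Type) (γ : ι → ℝ) (c : ι → ℂ), ∀ g : ℝ → ℂ, IsWeilTest g →
    HasSum (fun i => c i * weilMellin g (1 / 2 + (γ i : ℂ) * I)) (weilFunctional g)

/-- `X → X_ℂ-weights` (unit weights). [folklore] -/
theorem complexWeightedSpectralThesis_of_spectralThesis (h : SpectralThesis) :
    ComplexWeightedSpectralThesis := by
  obtain ⟨ι, γ, hγ⟩ := h
  exact ⟨ι, γ, fun _ => 1, fun g hg => by simpa using hγ g hg⟩

/-- **Even complex weights force bounded translates**: realness of the spectrum alone (with
unconditional summability) gives `sup_T ‖W(g(· - T))‖ ≤ Σ_i ‖c_i ĝ(1/2+iγ_i)‖ < ∞`. So neither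
POSITIVITY nor INTEGRALITY of the spectral measure is what carries RH in `X`: it is the realness of
its support (temperedness), read on the prime side as the square-root error term. [folklore] -/
theorem boundedTranslates_of_complexWeightedSpectralThesis (h : ComplexWeightedSpectralThesis) :
    BoundedTranslates := by
  obtain ⟨ι, γ, c, hγ⟩ := h
  intro g hg
  refine ⟨∑' i, ‖c i * weilMellin g (1 / 2 + (γ i : ℂ) * I)‖, fun T => ?_⟩
  have hT := hγ (weilTranslate g T) (hg.weilTranslate T)
  simp only [weilMellin_weilTranslate] at hT
  have hsumm : Summable fun i => ‖c i * weilMellin g (1 / 2 + (γ i : ℂ) * I)‖ :=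
    summable_norm_iff.2 (hγ g hg).summable
  have hnorm : ∀ i, ‖c i * (cexp ((1 / 2 + (γ i : ℂ) * I - 1 / 2) * (T : ℂ)) *
      weilMellin g (1 / 2 + (γ i : ℂ) * I))‖ = ‖c i * weilMellin g (1 / 2 + (γ i : ℂ) * I)‖ := by
    intro i
    rw [norm_mul, norm_mul, norm_mul, show (1 / 2 + (γ i : ℂ) * I - 1 / 2) * (T : ℂ) =
      ((γ i * T : ℝ) : ℂ) * I by push_cast; ring, Complex.norm_exp_ofReal_mul_I, one_mul]
  rw [← hT.tsum_eq]
  refine (norm_tsum_le_tsum_norm ?_).trans (le_of_eq (tsum_congr hnorm))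
  exact hsumm.congr fun i => (hnorm i).symm

end Translates

/-! ## §8 The converse: bounded translates force RH (classical Landau–Laplace argument, formalised) -/

section Laplace

/-- The zeros with multiplicity (index type of the explicit formula `hasSum_weilMellin_zeros`). [folklore] -/
abbrev Zmult : Type :=
  Σ ρ : ZetaZeros.riemannZetaNontrivialZeros, Fin (riemannZetaZeroOrder (ρ : ℂ)).toNat

instance countable_zmult : Countable Zmult := by
  haveI : Countable ZetaZeros.riemannZetaNontrivialZeros :=
    riemannZetaNontrivialZeros_countable.to_subtype
  infer_instance

/-! ### The test function aimed at a zero -/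

/-- The aimed test `g(t) = e^{-(s₀ - 1/2) t} b(t)` for a bump `b`. [folklore] -/
theorem isWeilTest_aimed (s₀ : ℂ) (b : ContDiffBump (0 : ℝ)) :
    IsWeilTest fun t : ℝ => cexp (-(s₀ - 1 / 2) * t) * (b t : ℂ) := by
  refine ⟨ContDiff.mul ?_ (Complex.ofRealCLM.contDiff.comp b.contDiff), ?_⟩
  · exact Complex.contDiff_exp.comp (contDiff_const.mul Complex.ofRealCLM.contDiff)
  · exact (b.hasCompactSupport.comp_left Complex.ofReal_zero).mul_left

/-- Its transform at `s₀` is `∫ b > 0`. [folklore] -/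
theorem weilMellin_aimed (s₀ : ℂ) (b : ContDiffBump (0 : ℝ)) :
    weilMellin (fun t : ℝ => cexp (-(s₀ - 1 / 2) * t) * (b t : ℂ)) s₀ = ((∫ t, b t : ℝ) : ℂ) := by
  unfold weilMellin
  rw [← integral_complex_ofReal]
  refine integral_congr_ae (Eventually.of_forall fun t => ?_)
  simp only
  rw [mul_comm (cexp _) ((b t : ℂ)), mul_assoc, ← Complex.exp_add, show -(s₀ - 1 / 2) * (t : ℂ) +
    (s₀ - 1 / 2) * t = 0 by ring, Complex.exp_zero, mul_one]

theorem weilMellin_aimed_ne_zero (s₀ : ℂ) (b : ContDiffBump (0 : ℝ)) :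
    weilMellin (fun t : ℝ => cexp (-(s₀ - 1 / 2) * t) * (b t : ℂ)) s₀ ≠ 0 := by
  rw [weilMellin_aimed, Ne, Complex.ofReal_eq_zero]
  exact b.integral_pos.ne'

/-! ### The explicit formula for translates -/

variable {g : ℝ → ℂ}

/-- `W(g(· - T)) = Σ_p e^{(ρ_p - 1/2) T} ĝ(ρ_p)` (absolutely convergent). [folklore] -/
theorem hasSum_translate (hg : IsWeilTest g) (T : ℝ) :
    HasSum (fun p : Zmult => cexp (((p.1 : ℂ) - 1 / 2) * T) * weilMellin g (p.1 : ℂ))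
      (weilFunctional (weilTranslate g T)) := by
  have h := hasSum_weilMellin_zeros (hg.weilTranslate T)
  simp only [weilMellin_weilTranslate] at h
  exact h

theorem summable_norm_weilMellin_zeros (hg : IsWeilTest g) :
    Summable fun p : Zmult => ‖weilMellin g (p.1 : ℂ)‖ :=
  summable_norm_iff.2 (hasSum_weilMellin_zeros hg).summable

/-! ### The Mellin-side function `t ↦ W(g(· + log t))` on `(0,1)` -/

/-- On `(0, 1)`: `W(g(· - (-log t))) = Σ_p ĝ(ρ_p) t^{-(ρ_p - 1/2)}`. [folklore] -/
theorem hasSum_cpow (hg : IsWeilTest g) {t : ℝ} (ht : 0 < t) :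
    HasSum (fun p : Zmult => weilMellin g (p.1 : ℂ) * (t : ℂ) ^ (-((p.1 : ℂ) - 1 / 2)))
      (weilFunctional (weilTranslate g (-Real.log t))) := by
  have h := hasSum_translate hg (-Real.log t)
  convert h using 2
  rename_i p
  rw [mul_comm, cpow_def_of_ne_zero (by exact_mod_cast ht.ne'), ← Complex.ofReal_log ht.le]
  congr 1
  push_cast
  ring_nf

/-- Norm of the general term on `(0,1)`: `‖ĝ(ρ) t^{-(ρ-1/2)}‖ = ‖ĝ(ρ)‖ t^{1/2 - Re ρ} ≤ ‖ĝ(ρ)‖ ε^{-1/2}`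
for `ε ≤ t < 1`, `0 < ε`. [folklore] -/
theorem norm_term_le (g : ℝ → ℂ) (p : Zmult) {ε t : ℝ} (hε : 0 < ε) (hεt : ε ≤ t) (ht1 : t < 1) :
    ‖weilMellin g (p.1 : ℂ) * (t : ℂ) ^ (-((p.1 : ℂ) - 1 / 2))‖ ≤
      ‖weilMellin g (p.1 : ℂ)‖ * ε ^ (-(1 / 2 : ℝ)) := by
  have ht : 0 < t := hε.trans_le hεt
  rw [norm_mul, Complex.norm_cpow_eq_rpow_re_of_pos ht]
  refine mul_le_mul_of_nonneg_left ?_ (norm_nonneg _)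
  have hre : (-((p.1 : ℂ) - 1 / 2)).re = 1 / 2 - (p.1 : ℂ).re := by simp
  rw [hre]
  have h0 := ZetaZeros.riemannZetaNontrivialZeros.re_pos p.1.2
  have h1 := ZetaZeros.riemannZetaNontrivialZeros.re_lt_one p.1.2
  -- `t^{1/2 - β} ≤ t^{-1/2} ≤ ε^{-1/2}` since `t < 1` and `-1/2 ≤ 1/2 - β`
  calc t ^ (1 / 2 - (p.1 : ℂ).re) ≤ t ^ (-(1 / 2 : ℝ)) :=
        Real.rpow_le_rpow_of_exponent_ge ht ht1.le (by linarith)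
    _ ≤ ε ^ (-(1 / 2 : ℝ)) :=
        Real.rpow_le_rpow_of_nonpos hε hεt (by norm_num)

/-- Continuity of `t ↦ W(g(· + log t))` on `(0, 1)`. [folklore] -/
theorem continuousOn_translate_log (hg : IsWeilTest g) :
    ContinuousOn (fun t : ℝ => weilFunctional (weilTranslate g (-Real.log t))) (Ioo 0 1) := by
  intro t ht
  have hε : 0 < t / 2 := by linarith [ht.1]
  -- continuity on `Ioo (t/2) 1` of the series, by uniform convergence
  have hcont : ContinuousOn (fun u : ℝ => ∑' p : Zmult,
      weilMellin g (p.1 : ℂ) * (u : ℂ) ^ (-((p.1 : ℂ) - 1 / 2))) (Ioo (t / 2) 1) := by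
    refine continuousOn_tsum (fun p => ?_)
      ((summable_norm_weilMellin_zeros hg).mul_right ((t / 2) ^ (-(1 / 2 : ℝ))))
      (fun p u hu => norm_term_le g p hε hu.1.le hu.2)
    refine ContinuousOn.mul continuousOn_const ?_
    refine ContinuousOn.cpow Complex.continuous_ofReal.continuousOn continuousOn_const ?_
    intro u hu
    exact Complex.ofReal_mem_slitPlane.2 (hε.trans hu.1)
  have heq : EqOn (fun u : ℝ => weilFunctional (weilTranslate g (-Real.log u)))
      (fun u : ℝ => ∑' p : Zmult, weilMellin g (p.1 : ℂ) * (u : ℂ) ^ (-((p.1 : ℂ) - 1 / 2)))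
      (Ioo (t / 2) 1) :=
    fun u hu => ((hasSum_cpow hg (hε.trans hu.1)).tsum_eq).symm
  have hmem : Ioo (t / 2) 1 ∈ nhds t := Ioo_mem_nhds (by linarith [ht.1]) ht.2
  exact ((hcont.congr heq).continuousAt hmem).continuousWithinAt

/-! ### The Mellin transform: holomorphy on `Re z > 0`, termwise evaluation on `Re z > 1` -/

/-- The Mellin-side function `f = 𝟙_{(0,1)} · (t ↦ W(g(· + log t)))`. [folklore] -/
def mellinSide (g : ℝ → ℂ) : ℝ → ℂ :=
  (Ioo (0 : ℝ) 1).indicator fun t => weilFunctional (weilTranslate g (-Real.log t))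

theorem norm_mellinSide_le {C : ℝ} (hB : ∀ T : ℝ, ‖weilFunctional (weilTranslate g T)‖ ≤ C) (t : ℝ) :
    ‖mellinSide g t‖ ≤ C :=
  (norm_indicator_le_norm_self _ _).trans (hB _)

theorem integrable_mellinSide (hg : IsWeilTest g) {C : ℝ}
    (hB : ∀ T : ℝ, ‖weilFunctional (weilTranslate g T)‖ ≤ C) :
    Integrable (mellinSide g) := by
  refine (integrable_indicator_iff measurableSet_Ioo).2 ?_
  have hmeas : AEStronglyMeasurable (fun t : ℝ => weilFunctional (weilTranslate g (-Real.log t)))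
      (volume.restrict (Ioo (0 : ℝ) 1)) :=
    (continuousOn_translate_log hg).aestronglyMeasurable measurableSet_Ioo
  exact (integrable_const C).mono' hmeas (ae_of_all _ fun t => hB _)

/-- **The Laplace transform is holomorphic on `Re z > 0`** (as a Mellin transform of a bounded
function supported in `(0, 1)`). [folklore] -/
theorem differentiableOn_mellin_mellinSide (hg : IsWeilTest g) {C : ℝ}
    (hB : ∀ T : ℝ, ‖weilFunctional (weilTranslate g T)‖ ≤ C) :
    DifferentiableOn ℂ (mellin (mellinSide g)) {z : ℂ | 0 < z.re} := by
  intro z hz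
  have hloc : LocallyIntegrableOn (mellinSide g) (Ioi 0) :=
    (integrable_mellinSide hg hB).locallyIntegrable.locallyIntegrableOn _
  have htop : mellinSide g =O[atTop] fun x : ℝ => x ^ (-(z.re + 1)) := by
    refine IsBigO.of_bound 0 ?_
    filter_upwards [Ici_mem_atTop (1 : ℝ)] with x hx
    rw [mellinSide, Set.indicator_of_notMem (fun h => not_lt.2 (Set.mem_Ici.1 hx) h.2), norm_zero,
      zero_mul]
  have hbot : mellinSide g =O[nhdsWithin 0 (Ioi 0)] fun x : ℝ => x ^ (-(0 : ℝ)) := by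
    refine IsBigO.of_bound C ?_
    filter_upwards [self_mem_nhdsWithin] with x hx
    rw [neg_zero, Real.rpow_zero, norm_one, mul_one]
    exact norm_mellinSide_le hB x
  exact (mellin_differentiableAt_of_isBigO_rpow hloc htop (by simp) hbot hz).differentiableWithinAt

/-- `∫₀¹ t^{w-1} dt = 1/w` for `Re w > 0`. [folklore] -/
theorem integral_Ioo_cpow {w : ℂ} (hw : 0 < w.re) :
    ∫ t in Ioo (0 : ℝ) 1, (t : ℂ) ^ (w - 1) = 1 / w := by
  have hw0 : w ≠ 0 := fun h => by rw [h, Complex.zero_re] at hw; exact lt_irrefl _ hw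
  rw [← integral_Ioc_eq_integral_Ioo, ← intervalIntegral.integral_of_le zero_le_one,
    integral_cpow (Or.inl (by simp; linarith))]
  simp only [sub_add_cancel, Complex.ofReal_one, Complex.one_cpow, Complex.ofReal_zero,
    Complex.zero_cpow hw0, sub_zero]

/-- The real companion: `t ↦ t^{-1/2}` is integrable on `(0,1)` with integral `2`. [folklore] -/
theorem integral_Ioo_rpow_neg_half : ∫ t in Ioo (0 : ℝ) 1, t ^ (-(1 / 2 : ℝ)) = 2 := by
  rw [← integral_Ioc_eq_integral_Ioo, ← intervalIntegral.integral_of_le zero_le_one,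
    integral_rpow (Or.inl (by norm_num))]
  norm_num

theorem integrableOn_rpow_neg_half : IntegrableOn (fun t : ℝ => t ^ (-(1 / 2 : ℝ))) (Ioo 0 1) := by
  rw [← intervalIntegrable_iff_integrableOn_Ioo_of_le zero_le_one]
  exact intervalIntegral.intervalIntegrable_rpow' (by norm_num)

/-- Norm of the integrand term on `(0,1)` for `1 < Re z`: `≤ ‖ĝ(ρ)‖ t^{-1/2}`. [folklore] -/
theorem norm_integrand_le (g : ℝ → ℂ) {z : ℂ} (hz : 1 < z.re) (p : Zmult) {t : ℝ}
    (ht : t ∈ Ioo (0 : ℝ) 1) :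
    ‖weilMellin g (p.1 : ℂ) * (t : ℂ) ^ (z - ((p.1 : ℂ) - 1 / 2) - 1)‖ ≤
      ‖weilMellin g (p.1 : ℂ)‖ * t ^ (-(1 / 2 : ℝ)) := by
  rw [norm_mul, Complex.norm_cpow_eq_rpow_re_of_pos ht.1]
  refine mul_le_mul_of_nonneg_left ?_ (norm_nonneg _)
  have h1 := ZetaZeros.riemannZetaNontrivialZeros.re_lt_one p.1.2
  refine Real.rpow_le_rpow_of_exponent_ge ht.1 ht.2.le ?_
  simp only [sub_re, one_re, div_ofNat_re]
  linarith

theorem integrable_term (g : ℝ → ℂ) {z : ℂ} (hz : 1 < z.re) (p : Zmult) :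
    Integrable (fun t : ℝ => weilMellin g (p.1 : ℂ) * (t : ℂ) ^ (z - ((p.1 : ℂ) - 1 / 2) - 1))
      (volume.restrict (Ioo (0 : ℝ) 1)) := by
  refine Integrable.mono' (integrableOn_rpow_neg_half.const_mul ‖weilMellin g (p.1 : ℂ)‖) ?_ ?_
  · refine ContinuousOn.aestronglyMeasurable ?_ measurableSet_Ioo
    refine ContinuousOn.mul continuousOn_const ?_
    refine ContinuousOn.cpow Complex.continuous_ofReal.continuousOn continuousOn_const ?_
    exact fun u hu => Complex.ofReal_mem_slitPlane.2 hu.1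
  · exact (ae_restrict_iff' measurableSet_Ioo).2 (ae_of_all _ fun t ht => norm_integrand_le g hz p ht)

/-- **Termwise evaluation**: for `1 < Re z`,
`mellin f z = Σ_p ĝ(ρ_p) / (z - (ρ_p - 1/2))`. [folklore] -/
theorem mellin_mellinSide_eq_tsum (hg : IsWeilTest g) {z : ℂ} (hz : 1 < z.re) :
    mellin (mellinSide g) z = ∑' p : Zmult, weilMellin g (p.1 : ℂ) / (z - ((p.1 : ℂ) - 1 / 2)) := by
  -- reduce to an integral over `(0,1)`
  have h1' : mellin (mellinSide g) z =
      ∫ t in Ioo (0 : ℝ) 1, (t : ℂ) ^ (z - 1) * weilFunctional (weilTranslate g (-Real.log t)) := by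
    rw [mellin]
    have : ∀ t : ℝ, (t : ℂ) ^ (z - 1) • mellinSide g t =
        (Ioo (0 : ℝ) 1).indicator (fun t => (t : ℂ) ^ (z - 1) *
          weilFunctional (weilTranslate g (-Real.log t))) t := by
      intro t
      rw [mellinSide, smul_eq_mul, Set.indicator_mul_right]
    simp_rw [this]
    rw [setIntegral_indicator measurableSet_Ioo, Set.inter_eq_right.2 Ioo_subset_Ioi_self]
  -- expand the integrand as a series
  have h2 : EqOn (fun t : ℝ => (t : ℂ) ^ (z - 1) * weilFunctional (weilTranslate g (-Real.log t)))
      (fun t : ℝ => ∑' p : Zmult, weilMellin g (p.1 : ℂ) * (t : ℂ) ^ (z - ((p.1 : ℂ) - 1 / 2) - 1))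
      (Ioo (0 : ℝ) 1) := by
    intro t ht
    have ht0 : (t : ℂ) ≠ 0 := by exact_mod_cast ht.1.ne'
    simp only
    rw [← (hasSum_cpow hg ht.1).tsum_eq, ← tsum_mul_left]
    refine tsum_congr fun p => ?_
    rw [mul_left_comm, ← Complex.cpow_add _ _ ht0]
    congr 2
    ring
  rw [h1', setIntegral_congr_fun measurableSet_Ioo h2]
  -- interchange sum and integral
  rw [← integral_tsum_of_summable_integral_norm (integrable_term g hz) ?_]
  · refine tsum_congr fun p => ?_
    rw [integral_const_mul, show z - ((p.1 : ℂ) - 1 / 2) - 1 = (z - ((p.1 : ℂ) - 1 / 2)) - 1 by ring,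
      integral_Ioo_cpow, mul_one_div]
    have h0 := ZetaZeros.riemannZetaNontrivialZeros.re_lt_one p.1.2
    simp only [sub_re, div_ofNat_re, one_re]
    linarith
  · refine Summable.of_nonneg_of_le (fun p => integral_nonneg fun _ => norm_nonneg _)
      (fun p => ?_) ((summable_norm_weilMellin_zeros hg).mul_right 2)
    calc ∫ t in Ioo (0 : ℝ) 1, ‖weilMellin g (p.1 : ℂ) * (t : ℂ) ^ (z - ((p.1 : ℂ) - 1 / 2) - 1)‖
        ≤ ∫ t in Ioo (0 : ℝ) 1, ‖weilMellin g (p.1 : ℂ)‖ * t ^ (-(1 / 2 : ℝ)) := by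
          refine setIntegral_mono_on (integrable_term g hz p).norm
            (integrableOn_rpow_neg_half.const_mul _) measurableSet_Ioo fun t ht => ?_
          exact norm_integrand_le g hz p ht
      _ = ‖weilMellin g (p.1 : ℂ)‖ * 2 := by
          rw [integral_const_mul, integral_Ioo_rpow_neg_half]

/-! ### Pole structure of the zero sum -/

/-- Summability of the partial fractions `ĝ(ρ_p)/(z - (ρ_p - 1/2))` for `1 < Re z`. [folklore] -/
theorem summable_partialFraction (hg : IsWeilTest g) {z : ℂ} (hz : 1 < z.re) :
    Summable fun p : Zmult => weilMellin g (p.1 : ℂ) / (z - ((p.1 : ℂ) - 1 / 2)) := by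
  refine Summable.of_norm_bounded ((summable_norm_weilMellin_zeros hg).div_const (1 / 2)) fun p => ?_
  rw [norm_div]
  have h1 := ZetaZeros.riemannZetaNontrivialZeros.re_lt_one p.1.2
  have hden : (1 / 2 : ℝ) ≤ ‖z - ((p.1 : ℂ) - 1 / 2)‖ := by
    refine le_trans ?_ (Complex.re_le_norm _)
    simp only [sub_re, div_ofNat_re, one_re]
    linarith
  exact div_le_div_of_nonneg_left (norm_nonneg _) one_half_pos hden

/-- **The margin**: on `U = {η < Re z, |Im z - γ₀| < 1}` every pole `ρ_p - 1/2` of a zero OUTSIDE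
`S = {|Im ρ - γ₀| < 2, 1/2 < Re ρ}` stays at distance `≥ min 1 η`. [folklore] -/
theorem margin_le {η γ₀ : ℝ} {z : ℂ} (hz1 : η < z.re) (hz2 : |z.im - γ₀| < 1)
    (p : Zmult) (hp : ¬ (|(p.1 : ℂ).im - γ₀| < 2 ∧ 1 / 2 < (p.1 : ℂ).re)) :
    min 1 η ≤ ‖z - ((p.1 : ℂ) - 1 / 2)‖ := by
  rcases not_and_or.1 hp with h | h
  · -- far in the imaginary direction
    rw [not_lt] at h
    refine (min_le_left _ _).trans (le_trans ?_ (Complex.abs_im_le_norm _))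
    simp only [sub_im, div_ofNat_im, one_im, zero_div, sub_zero]
    have h1 : |z.im - γ₀| < 1 := hz2
    rw [abs_lt] at h1
    rcases le_abs.1 h with h2 | h2
    · exact le_abs.2 (Or.inr (by linarith [h1.2]))
    · exact le_abs.2 (Or.inl (by linarith [h1.1]))
  · -- pole in the closed left half-plane
    rw [not_lt] at h
    refine (min_le_right _ _).trans (le_trans ?_ (Complex.re_le_norm _))
    simp only [sub_re, div_ofNat_re, one_re]
    linarith

/-- Differentiability of the partial-fraction TAIL (poles outside `S`) on `U`. [folklore] -/
theorem differentiableOn_tail (hg : IsWeilTest g) {η γ₀ : ℝ} (hη : 0 < η) (E : Finset Zmult)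
    (hE : ∀ p : Zmult, p ∉ E → ¬ (|(p.1 : ℂ).im - γ₀| < 2 ∧ 1 / 2 < (p.1 : ℂ).re)) :
    DifferentiableOn ℂ (fun z => ∑' p : {p // p ∉ E},
      weilMellin g (p.1.1 : ℂ) / (z - ((p.1.1 : ℂ) - 1 / 2)))
      ({z : ℂ | η < z.re} ∩ ({z : ℂ | z.im < γ₀ + 1} ∩ {z : ℂ | γ₀ - 1 < z.im})) := by
  have hm : 0 < min 1 η := lt_min one_pos hη
  have hmem : ∀ z : ℂ, z ∈ ({z : ℂ | η < z.re} ∩ ({z : ℂ | z.im < γ₀ + 1} ∩ {z : ℂ | γ₀ - 1 < z.im})) →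
      η < z.re ∧ |z.im - γ₀| < 1 := by
    rintro z ⟨h1, h2, h3⟩
    have h1' : η < z.re := h1
    have h2' : z.im < γ₀ + 1 := h2
    have h3' : γ₀ - 1 < z.im := h3
    exact ⟨h1', abs_lt.2 ⟨by linarith, by linarith⟩⟩
  refine differentiableOn_tsum_of_summable_norm
    (u := fun p : {p // p ∉ E} => ‖weilMellin g (p.1.1 : ℂ)‖ / min 1 η)
    (((summable_norm_weilMellin_zeros hg).subtype _).div_const _) (fun p => ?_) ?_ (fun p z hz => ?_)
  · refine DifferentiableOn.div (differentiableOn_const _)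
      (differentiableOn_id.sub (differentiableOn_const _)) fun z hz h0 => ?_
    have h := margin_le (hmem z hz).1 (hmem z hz).2 p.1 (hE p.1 p.2)
    rw [h0, norm_zero] at h
    exact not_lt.2 h hm
  · exact (isOpen_lt continuous_const Complex.continuous_re).inter
      ((isOpen_lt Complex.continuous_im continuous_const).inter
        (isOpen_lt continuous_const Complex.continuous_im))
  · rw [norm_div]
    exact div_le_div_of_nonneg_left (norm_nonneg _) hm
      (margin_le (hmem z hz).1 (hmem z hz).2 p.1 (hE p.1 p.2))

/-! ### Bounded translates force RH -/

/-- **Bounded translates of the Weil functional force the Riemann hypothesis.** If for every Weil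
test `g` the function `T ↦ W(g(· - T))` is bounded on `ℝ`, then RH holds. Proof: for a zero `s₀`
with `1/2 < Re s₀ < 1` aim a test at `s₀` (`ĝ(s₀) = ∫ b > 0`); the Laplace–Mellin transform of the
bounded translate function is holomorphic on `Re z > 0`, but equals the partial-fraction series
`Σ_p ĝ(ρ_p)/(z - (ρ_p - 1/2))` on `Re z > 1`, whose tail is holomorphic near `s₀ - 1/2` while the
finitely many nearby terms form a rational function with a genuine pole at `s₀ - 1/2`; clearing
denominators and the identity theorem on a convex half-strip give a contradiction. [folklore] -/
theorem riemannHypothesis_of_forall_bounded_weilTranslate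
    (hB : ∀ g : ℝ → ℂ, IsWeilTest g → ∃ C : ℝ, ∀ T : ℝ, ‖weilFunctional (weilTranslate g T)‖ ≤ C) :
    RiemannHypothesis := by
  classical
  refine quasiRiemannHypothesis_one_half_iff_holds.1 fun s₀ hζ hlo hhi => ?_
  -- the zero as an element of the index of zeros, and the aimed test
  have hs₀mem : s₀ ∈ ZetaZeros.riemannZetaNontrivialZeros :=
    ZetaZeros.riemannZetaNontrivialZeros.mem_of_re_pos hζ (by linarith)
  set ρ₀ : ZetaZeros.riemannZetaNontrivialZeros := ⟨s₀, hs₀mem⟩ with hρ₀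
  let b : ContDiffBump (0 : ℝ) := ⟨1, 2, one_pos, one_lt_two⟩
  set g : ℝ → ℂ := fun t : ℝ => cexp (-(s₀ - 1 / 2) * t) * (b t : ℂ) with hg_def
  have hg : IsWeilTest g := isWeilTest_aimed s₀ b
  have hgs₀ : weilMellin g s₀ ≠ 0 := weilMellin_aimed_ne_zero s₀ b
  obtain ⟨C, hC⟩ := hB g hg
  -- geometry: `η`, `γ₀`, the half-strip `U`
  set η : ℝ := (s₀.re - 1 / 2) / 2 with hη_def
  have hη : 0 < η := by rw [hη_def]; linarith
  set γ₀ : ℝ := s₀.im with hγ₀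
  set U : Set ℂ := {z : ℂ | η < z.re} ∩ ({z : ℂ | z.im < γ₀ + 1} ∩ {z : ℂ | γ₀ - 1 < z.im}) with hU
  have hUopen : IsOpen U :=
    (isOpen_lt continuous_const Complex.continuous_re).inter
      ((isOpen_lt Complex.continuous_im continuous_const).inter
        (isOpen_lt continuous_const Complex.continuous_im))
  have hUconv : Convex ℝ U :=
    (convex_halfSpace_re_gt η).inter ((convex_halfSpace_im_lt _).inter (convex_halfSpace_im_gt _))
  -- the finite set `S` of nearby zeros in the right half of the strip, with multiplicity `E`
  set S : Set ZetaZeros.riemannZetaNontrivialZeros :=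
    {ρ | |(ρ : ℂ).im - γ₀| < 2 ∧ 1 / 2 < (ρ : ℂ).re} with hS
  have hSfin : S.Finite := by
    refine Set.Finite.of_finite_image ?_ Subtype.val_injective.injOn
    refine (riemannZetaNontrivialZeros_finite_inter_ball s₀ 3).subset ?_
    rintro w ⟨ρ, hρ, rfl⟩
    refine ⟨ρ.2, ?_⟩
    rw [Metric.mem_ball, Complex.dist_eq]
    have h1 := ZetaZeros.riemannZetaNontrivialZeros.re_lt_one ρ.2
    have hre : |((ρ : ℂ) - s₀).re| < 1 := by
      rw [sub_re, abs_lt]; constructor <;> linarith [hρ.2]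
    have him : |((ρ : ℂ) - s₀).im| < 2 := by rw [sub_im]; exact hρ.1
    calc ‖(ρ : ℂ) - s₀‖ ≤ |((ρ : ℂ) - s₀).re| + |((ρ : ℂ) - s₀).im| := Complex.norm_le_abs_re_add_abs_im _
      _ < 3 := by linarith
  set E' : Finset ZetaZeros.riemannZetaNontrivialZeros := hSfin.toFinset with hE'
  have hmemE' : ∀ ρ, ρ ∈ E' ↔ |(ρ : ℂ).im - γ₀| < 2 ∧ 1 / 2 < (ρ : ℂ).re := fun ρ => by
    rw [hE', Set.Finite.mem_toFinset]; rfl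
  have hρ₀E' : ρ₀ ∈ E' := (hmemE' ρ₀).2 ⟨by simp [hρ₀, hγ₀], hlo⟩
  set E : Finset Zmult := E'.sigma fun _ => Finset.univ with hE
  have hmemE : ∀ p : Zmult, p ∈ E ↔ |(p.1 : ℂ).im - γ₀| < 2 ∧ 1 / 2 < (p.1 : ℂ).re := fun p => by
    rw [hE, Finset.mem_sigma, hmemE']; simp
  -- notation for the pieces
  set a : Zmult → ℂ := fun p => weilMellin g (p.1 : ℂ) with ha
  set Rtail : ℂ → ℂ := fun z => ∑' p : {p // p ∉ E}, a p.1 / (z - ((p.1.1 : ℂ) - 1 / 2)) with hRtail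
  set P : ℂ → ℂ := fun z => ∏ ρ ∈ E', (z - ((ρ : ℂ) - 1 / 2)) with hP
  set A : ZetaZeros.riemannZetaNontrivialZeros → ℂ :=
    fun ρ => ((riemannZetaZeroOrder (ρ : ℂ)).toNat : ℂ) * weilMellin g (ρ : ℂ) with hA
  set Ψ : ℂ → ℂ := fun z => ∑ ρ ∈ E', A ρ * ∏ ρ' ∈ E'.erase ρ, (z - ((ρ' : ℂ) - 1 / 2)) with hΨ
  set Φ : ℂ → ℂ := fun z => (mellin (mellinSide g) z - Rtail z) * P z with hΦ
  -- analyticity on `U`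
  have hUsub : U ⊆ {z : ℂ | 0 < z.re} := fun z hz => hη.trans hz.1
  have hRtail_diff : DifferentiableOn ℂ Rtail U :=
    differentiableOn_tail hg hη E fun p hp => by rwa [hmemE] at hp
  have hP_diff : DifferentiableOn ℂ P U :=
    DifferentiableOn.fun_finsetProd fun ρ _ => differentiableOn_id.sub (differentiableOn_const _)
  have hΦ_diff : DifferentiableOn ℂ Φ U :=
    (((differentiableOn_mellin_mellinSide hg hC).mono hUsub).sub hRtail_diff).mul hP_diff
  have hΨ_diff : DifferentiableOn ℂ Ψ U := by
    refine DifferentiableOn.fun_sum fun ρ _ => ?_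
    exact (differentiableOn_const _).mul
      (DifferentiableOn.fun_finsetProd fun ρ' _ => differentiableOn_id.sub (differentiableOn_const _))
  -- the identity `Φ = Ψ` on `U ∩ {1 < Re z}`
  have hEq : EqOn Φ Ψ (U ∩ {z : ℂ | 1 < z.re}) := by
    intro z hz
    have hz1 : 1 < z.re := hz.2
    have hne : ∀ ρ : ZetaZeros.riemannZetaNontrivialZeros, z - ((ρ : ℂ) - 1 / 2) ≠ 0 := by
      intro ρ h0
      have h1 := ZetaZeros.riemannZetaNontrivialZeros.re_lt_one ρ.2
      have := congrArg Complex.re h0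
      simp only [sub_re, div_ofNat_re, one_re, zero_re] at this
      linarith
    -- `mellin f z = Σ_E + tail`
    have hsplit : mellin (mellinSide g) z - Rtail z = ∑ p ∈ E, a p / (z - ((p.1 : ℂ) - 1 / 2)) := by
      rw [mellin_mellinSide_eq_tsum hg hz1, ← (summable_partialFraction hg hz1).sum_add_tsum_subtype_compl E]
      simp only [hRtail, ha, add_sub_cancel_right]
    -- group the finite part by zeros
    have hgroup : ∑ p ∈ E, a p / (z - ((p.1 : ℂ) - 1 / 2)) =
        ∑ ρ ∈ E', A ρ / (z - ((ρ : ℂ) - 1 / 2)) := by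
      rw [hE, Finset.sum_sigma]
      refine Finset.sum_congr rfl fun ρ _ => ?_
      simp only [ha, hA, Finset.sum_const, Finset.card_univ, Fintype.card_fin, nsmul_eq_mul]
      ring
    simp only [hΦ, hΨ]
    rw [hsplit, hgroup, Finset.sum_mul]
    refine Finset.sum_congr rfl fun ρ hρ => ?_
    rw [div_mul_eq_mul_div, mul_div_assoc]
    congr 1
    rw [div_eq_iff (hne ρ), hP]
    exact (Finset.prod_erase_mul E' (fun ρ' => z - ((ρ' : ℂ) - 1 / 2)) hρ).symm
  -- identity theorem on the convex open set `U`
  set z₁ : ℂ := ⟨2, γ₀⟩ with hz₁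
  have hη_lt : η < 1 / 4 := by rw [hη_def]; linarith
  have hz₁U : z₁ ∈ U := ⟨by show η < (2 : ℝ); linarith, by show (γ₀ : ℝ) < γ₀ + 1; linarith,
    by show γ₀ - 1 < (γ₀ : ℝ); linarith⟩
  have hVopen : IsOpen (U ∩ {z : ℂ | 1 < z.re}) :=
    hUopen.inter (isOpen_lt continuous_const Complex.continuous_re)
  have hz₁V : z₁ ∈ U ∩ {z : ℂ | 1 < z.re} := ⟨hz₁U, by show (1 : ℝ) < 2; norm_num⟩
  have hEqU : EqOn Φ Ψ U :=
    (hΦ_diff.analyticOnNhd hUopen).eqOn_of_preconnected_of_eventuallyEq (hΨ_diff.analyticOnNhd hUopen)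
      hUconv.isPreconnected hz₁U (eventuallyEq_of_mem (hVopen.mem_nhds hz₁V) hEq)
  -- evaluate at the pole `z⋆ = s₀ - 1/2 ∈ U`
  set zs : ℂ := s₀ - 1 / 2 with hzs
  have hzsU : zs ∈ U := by
    refine ⟨?_, ?_, ?_⟩
    · show η < (s₀ - 1 / 2).re
      simp only [sub_re, div_ofNat_re, one_re]; rw [hη_def]; linarith
    · show (s₀ - 1 / 2).im < γ₀ + 1
      simp [hγ₀]
    · show γ₀ - 1 < (s₀ - 1 / 2).im
      simp [hγ₀]
  have hΦzs : Φ zs = 0 := by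
    simp only [hΦ, hP]
    rw [Finset.prod_eq_zero hρ₀E' (by simp [hρ₀, hzs]), mul_zero]
  have hΨzs : Ψ zs ≠ 0 := by
    simp only [hΨ]
    rw [Finset.sum_eq_single_of_mem ρ₀ hρ₀E' (fun ρ hρ hne => ?_)]
    · refine mul_ne_zero (mul_ne_zero ?_ ?_) (Finset.prod_ne_zero_iff.2 fun ρ' hρ' => ?_)
      · have h1 := ZetaZeros.riemannZetaNontrivialZeros.one_le_order hs₀mem
        have : (1 : ℕ) ≤ (riemannZetaZeroOrder (ρ₀ : ℂ)).toNat := by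
          rw [hρ₀]; simp only; omega
        exact_mod_cast (Nat.one_le_iff_ne_zero.1 this)
      · simpa [hρ₀] using hgs₀
      · intro h0
        have hne' : ρ' ≠ ρ₀ := (Finset.mem_erase.1 hρ').1
        apply hne'
        apply Subtype.ext
        have : (ρ' : ℂ) = s₀ := by
          have := h0; rw [hzs] at this
          linear_combination -this
        simpa [hρ₀] using this
    · -- the other summands vanish at `zs` (their product contains the factor of `ρ₀`)
      refine mul_eq_zero_of_right _ (Finset.prod_eq_zero (Finset.mem_erase.2 ⟨hne.symm, hρ₀E'⟩) ?_)
      simp [hρ₀, hzs]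
  exact hΨzs ((hEqU hzsU).symm.trans hΦzs ▸ rfl)


end Laplace

/-- **`BoundedTranslates → RH`** (was the near-miss of cycle 1; now proved). [folklore] -/
theorem riemannHypothesis_of_boundedTranslates (h : BoundedTranslates) : _root_.RiemannHypothesis :=
  riemannHypothesis_of_forall_bounded_weilTranslate h

/-- **`BoundedTranslates ↔ RH`.** [folklore] -/
theorem boundedTranslates_iff_riemannHypothesis : BoundedTranslates ↔ _root_.RiemannHypothesis :=
  ⟨riemannHypothesis_of_boundedTranslates, fun hRH =>
    boundedTranslates_of_spectralThesis (spectralThesis_of_riemannHypothesis hRH)⟩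

/-- **`X_ℂ-weights ↔ RH`**: the relaxation of `X` with arbitrary complex weights on a real spectrum
is again exactly RH. [folklore] -/
theorem complexWeightedSpectralThesis_iff_riemannHypothesis :
    ComplexWeightedSpectralThesis ↔ _root_.RiemannHypothesis :=
  ⟨fun h => riemannHypothesis_of_boundedTranslates (boundedTranslates_of_complexWeightedSpectralThesis h),
    fun hRH => complexWeightedSpectralThesis_of_spectralThesis (spectralThesis_of_riemannHypothesis hRH)⟩

/-- **The grand chain**: `X`, its positively weighted, complex-weighted, even-test and
positive-spectrum-on-even-tests relaxations, bounded translates, and RH are all equivalent. What `X`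
asserts beyond a theorem (`spectralThesisStrip_holds`) is precisely the realness of the spectrum,
i.e. RH; integrality and positivity add only the rigidity content (item 0195). [folklore] -/
theorem spectralThesis_tfae : List.TFAE
    [SpectralThesis, WeightedSpectralThesis, ComplexWeightedSpectralThesis, SpectralThesisEven,
      SpectralThesisEvenPos, BoundedTranslates, _root_.RiemannHypothesis] := by
  have h1 := spectralThesis_iff_riemannHypothesis
  have h2 := weightedSpectralThesis_iff_riemannHypothesis
  have h3 := complexWeightedSpectralThesis_iff_riemannHypothesis
  have h4 := spectralThesisEven_iff_riemannHypothesis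
  have h5 := spectralThesisEvenPos_iff_riemannHypothesis
  have h6 := boundedTranslates_iff_riemannHypothesis
  tfae_have 1 ↔ 7 := h1
  tfae_have 2 ↔ 7 := h2
  tfae_have 3 ↔ 7 := h3
  tfae_have 4 ↔ 7 := h4
  tfae_have 5 ↔ 7 := h5
  tfae_have 6 ↔ 7 := h6
  tfae_finish

-- Targets: none registered (payload `targets = []`, `stuck_stubs = []`).

end Summit.RiemannHypothesis.RiemannHypothesis.Cruxes.SpectralThesis.Disproof

end
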